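import Literature.NumberTheory.Sieve.IwaniecAlmostPrimesQuadraticWeightedSum
import Literature.NumberTheory.Sieve.IwaniecAlmostPrimesNumerics
import HarnessLib

/-!
# Iwaniec (1978) for a general quadratic, §6: the Theorem from Proposition 2 for `𝒜_G` — PROVED

Sequel to `IwaniecAlmostPrimesQuadratic.lean` and `IwaniecAlmostPrimesQuadraticWeightedSum.lean`
(H. Iwaniec, *Almost-primes represented by quadratic polynomials*, Invent. Math. **47** (1978)
171–188 [cite: IwaniecInventiones1978, §6 pp. 186–187]; R. J. Lemke Oliver, *Almost-primes
represented by quadratic polynomials*, Acta Arith. **151** (2012) 241–261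
[cite: LemkeOliverActaArith2012, §2.2–2.3]).  The first file reduced Iwaniec's Theorem for a
general `G = aX² + bX + c` (`theorem_quadratic`: `a > 0`, `c` odd, `G` irreducible ⟹
`#{n ≤ x : G(n) = P₂} > (Γ_G/77) x/log x`) to the weighted-sieve lower bound
`W(𝒜_G, x^{1/5}) ≥ C Γ_G x/log x` with some `C > 1/77` (`theorem_quadratic_of_weightedSumG_lower`).
This file carries out the whole of Iwaniec's §6 / Lemke Oliver's §2.3 for general `G` and PROVES
that lower bound — with its constant — from Proposition 2 for the sequence `𝒜_G = {G(n) : n ≤ x}`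
(Iwaniec p. 185; Lemke Oliver's Lemma 5, "essentially the same as Proposition 2 in [8]"), the
numerical inequality of p. 187 being the tree's `IsLinearSieveFunctions.numerics`:

* `proposition2G_upper a b c`, `proposition2G_lower_const a b c` — the two halves of
  Proposition 2 for `𝒜_G` as PREDICATES of the coefficients (hypotheses of the theorems below, in
  the exact shape of the `n² + 1` facts `proposition2_upper`, `proposition2_lower_const` with
  `S(𝒜_q, u)`, `ρ`, `V` replaced by `siftedCountG`, `rhoG`, `densityProdG`);
* `tendsto_sum_Ioc_rhoWeightG`, `MA_leG`, `MB_leG`, `M2_leG` — the prime sums of p. 186 for `ρ_G`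
  tend to (at most) the integrals `T3, T4, T5` (partial summation against
  `∑_{p ≤ t} ρ_G(p)/p = log log t + b_G + o(1)`, `rhoMertensG`);
* `weightedSumG_ge_of_prop2G_const` — **§6 assembled for general `G`**: for `0 < ε ≤ 1/8` and
  large `x`, `W(𝒜_G, z) ≥ V_G(z) x {f(16/3) − Σ_A − Σ_B − Σ₂ − C ε}` (`z = x^{1/5}`), from identity
  (3) at the size parameter `X = Kx` (`weightedSumG_eq`) and the families of p. 186.  New points
  against `n² + 1`: the weights carry `log X = log x + log K` instead of `log x` (costing
  `O(log K/log x)` against the bounded sums `∑_{z ≤ p < x} ρ_G(p)/p`), the primes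
  `x^{1/2} ≤ p < X^{1/2}` of the first sum of (3) form an extra family whose main term
  `∑_{x^{1/2} ≤ p < (Kx)^{1/2}} ρ_G(p)/p → 0`, and the tail `x^{1−ε} ≤ p < X` of (22) has
  coefficients `≤ ε + log K/log x ≤ 2ε` (absorbed by `sum_siftedCountG_le_four_mul`);
* `exists_gt_weightedSumG_ge_of_prop2G_const` — `∃ c > Γ_G/77, W(𝒜_G, x^{1/5}) ≥ c x/log x`
  for large `x` (the §6 evaluation with its slack, `V_G(z) log z → 2Γ_G e^{−γ}`);
* **`theorem_quadratic_of_prop2G`** — `(∀ G as in the Theorem, proposition2G_upper G ∧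
  proposition2G_lower_const G) → theorem_quadratic`; and for a single `G`,
  `infinite_setOf_isAtMostAlmostPrime_of_prop2G` (the qualitative half, `G(n) = P₂` infinitely
  often).

So Iwaniec's Theorem for every `G` now rests on Proposition 2 for `𝒜_G` alone, i.e. (Lemke
Oliver §2.2) on Iwaniec's bilinear-remainder linear sieve (`lemma2_bilinearSieve`, Acta Arith. 37
(1980) Thm 1) and a level of distribution `x^{16/15}` in bilinear form for `𝒜_G` (Iwaniec's
Corollary of Proposition 1 for general `G`; Lemke Oliver's Lemmas 3–4 and §3).  No named fact is
introduced: the two predicates are definitions with parameters, used only as hypotheses.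

## References

* H. Iwaniec, Invent. Math. 47 (1978) 171–188, Proposition 2 and §6 (`IwaniecInventiones1978`).
* R. J. Lemke Oliver, Acta Arith. 151 (2012) 241–261, Lemma 5 and §2.3
  (`LemkeOliverActaArith2012`).
-/

open Filter Finset Real Polynomial MeasureTheory intervalIntegral
open scoped Topology

noncomputable section

namespace Literature.NumberTheory.Sieve.Iwaniec1978

variable {a b c : ℤ}

/-! ### Proposition 2 for `𝒜_G` — the statements (predicates of `a, b, c`) -/

open scoped Classical in
/-- **Iwaniec's Proposition 2 (p. 185) / Lemke Oliver's Lemma 5, upper bound, for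
`𝒜_G = {G(n) : 1 ≤ n ≤ x}` — the STATEMENT, as a predicate of the coefficients.**  Let
`y = x^{16/15}`, `0 < γ < 1/2`, `z = x^γ`, `z ≤ z_q < x^{1/2}` and `0 ≤ c_q ≤ 1`.  Then for any
`ε > 0` and `x > x₀(ε, γ)` (uniformly in the families `c_q`, `z_q`),
`∑_{q < x^{1−ε}, (q, P(z_q)) = 1} c_q S(𝒜_q; z_q)
   ≤ V_G(z) x {∑_{q < x^{1−ε}, (q, P(z_q)) = 1} c_q (ρ_G(q)/q) F(log(y/q)/log z_q)(log z/log z_q)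
             + O_γ(ε)}`,
`F` any upper linear-sieve function (`IsLinearSieveFunctions`).  This is `proposition2_upper`
with `𝒜 = {n² + 1}` replaced by `𝒜_G`; it is used below only as a hypothesis (Lemke Oliver
derives it from Iwaniec's bilinear sieve and his Lemma 3, the level of distribution of `𝒜_G`).
[cite: LemkeOliverActaArith2012, Lemma 5] -/
def proposition2G_upper (a b c : ℤ) : Prop :=
  ∀ (F f : ℝ → ℝ), IsLinearSieveFunctions F f →
    ∀ γ : ℝ, 0 < γ → γ < 1 / 2 → ∃ Cγ : ℝ, ∀ ε : ℝ, 0 < ε → ∃ x₀ : ℝ, ∀ x : ℝ, x₀ ≤ x →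
      ∀ (zq : ℕ → ℝ) (cq : ℕ → ℝ), (∀ q, x ^ γ ≤ zq q ∧ zq q < x ^ (1 / 2 : ℝ)) →
        (∀ q, 0 ≤ cq q ∧ cq q ≤ 1) →
        let Q := (Finset.Ico 1 ⌈x ^ (1 - ε)⌉₊).filter fun q : ℕ =>
          q.Coprime (primesProdBelow (zq q))
        ∑ q ∈ Q, cq q * (siftedCountG a b c x q (zq q) : ℝ) ≤
          densityProdG a b c (x ^ γ) * x *
            (∑ q ∈ Q, cq q * (rhoG a b c q : ℝ) / q *
                F (Real.log (x ^ (16 / 15 : ℝ) / q) / Real.log (zq q)) *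
                  (Real.log (x ^ γ) / Real.log (zq q)) + Cγ * ε)

open scoped Classical in
/-- **Iwaniec's Proposition 2 / Lemke Oliver's Lemma 5, lower bound at a constant sieving level
`Z`, for `𝒜_G` — the STATEMENT, as a predicate of the coefficients** ("A similar result holds
for lower bound, the function `F(s)` being replaced by `f(s)`", p. 185; constant level
`z ≤ Z < x^{1/2}` is the only form §6 uses, through `S(𝒜, z)`):
`∑_{q < x^{1−ε}, (q, P(Z)) = 1} c_q S(𝒜_q; Z)
   ≥ V_G(z) x {∑ c_q (ρ_G(q)/q) f(log(y/q)/log Z)(log z/log Z) − O_γ(ε)}`.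
The `𝒜_G`-version of `proposition2_lower_const`. [cite: LemkeOliverActaArith2012, Lemma 5] -/
def proposition2G_lower_const (a b c : ℤ) : Prop :=
  ∀ (F f : ℝ → ℝ), IsLinearSieveFunctions F f →
    ∀ γ : ℝ, 0 < γ → γ < 1 / 2 → ∃ Cγ : ℝ, ∀ ε : ℝ, 0 < ε → ∃ x₀ : ℝ, ∀ x : ℝ, x₀ ≤ x →
      ∀ (Z : ℝ) (cq : ℕ → ℝ), (x ^ γ ≤ Z ∧ Z < x ^ (1 / 2 : ℝ)) →
        (∀ q, 0 ≤ cq q ∧ cq q ≤ 1) →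
        let Q := (Finset.Ico 1 ⌈x ^ (1 - ε)⌉₊).filter fun q : ℕ =>
          q.Coprime (primesProdBelow Z)
        densityProdG a b c (x ^ γ) * x *
            (∑ q ∈ Q, cq q * (rhoG a b c q : ℝ) / q *
                f (Real.log (x ^ (16 / 15 : ℝ) / q) / Real.log Z) *
                  (Real.log (x ^ γ) / Real.log Z) - Cγ * ε) ≤
          ∑ q ∈ Q, cq q * (siftedCountG a b c x q Z : ℝ)

/-! ### Proposition 2 for `𝒜_G` specialised to families (`γ = 1/5`) -/

section Families

open scoped Classical in
/-- **Prop. 2 for `𝒜_G` (upper) for a family supported on a finset `T`** (the form applied on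
p. 186). [cite: IwaniecInventiones1978, Proposition 2] -/
theorem prop2G_upper_family (h2u : proposition2G_upper a b c) {F f : ℝ → ℝ}
    (hFf : IsLinearSieveFunctions F f) :
    ∃ Cu : ℝ, ∀ ε : ℝ, 0 < ε → ∃ x₀ : ℝ, ∀ x : ℝ, x₀ ≤ x →
      ∀ (T : Finset ℕ) (zq cq : ℕ → ℝ),
        (∀ q, x ^ (1 / 5 : ℝ) ≤ zq q ∧ zq q < x ^ (1 / 2 : ℝ)) → (∀ q, 0 ≤ cq q ∧ cq q ≤ 1) →
        (∀ q, q ∉ T → cq q = 0) →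
        (∀ q ∈ T, 1 ≤ q ∧ (q : ℝ) < x ^ (1 - ε) ∧ q.Coprime (primesProdBelow (zq q))) →
        ∑ q ∈ T, cq q * (siftedCountG a b c x q (zq q) : ℝ) ≤
          densityProdG a b c (x ^ (1 / 5 : ℝ)) * x *
            (∑ q ∈ T, cq q * (rhoG a b c q : ℝ) / q *
                F (Real.log (x ^ (16 / 15 : ℝ) / q) / Real.log (zq q)) *
                  (Real.log (x ^ (1 / 5 : ℝ)) / Real.log (zq q)) + Cu * ε) := by
  obtain ⟨Cu, hCu⟩ := h2u F f hFf (1 / 5) (by norm_num) (by norm_num)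
  refine ⟨Cu, fun ε hε => ?_⟩
  obtain ⟨x₀, hx₀⟩ := hCu ε hε
  refine ⟨x₀, fun x hx T zq cq hzq hc hcT hT => ?_⟩
  have h := hx₀ x hx zq cq hzq hc
  simp only [] at h
  have hTQ : T ⊆ (Finset.Ico 1 ⌈x ^ (1 - ε)⌉₊).filter
      fun q : ℕ => q.Coprime (primesProdBelow (zq q)) :=
    fun q hq => mem_propQ (hT q hq).1 (hT q hq).2.1 (hT q hq).2.2
  rw [sum_filter_support hTQ (fun q hq => by rw [hcT q hq]; simp),
    sum_filter_support hTQ (fun q hq => by rw [hcT q hq]; simp)] at h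
  exact h

open scoped Classical in
/-- **Prop. 2 for `𝒜_G` (lower, constant level) for a family supported on a finset `T`.**
[cite: IwaniecInventiones1978, Proposition 2] -/
theorem prop2G_lower_family_const (h2l : proposition2G_lower_const a b c) {F f : ℝ → ℝ}
    (hFf : IsLinearSieveFunctions F f) :
    ∃ Cl : ℝ, ∀ ε : ℝ, 0 < ε → ∃ x₀ : ℝ, ∀ x : ℝ, x₀ ≤ x →
      ∀ (T : Finset ℕ) (Z : ℝ) (cq : ℕ → ℝ),
        (x ^ (1 / 5 : ℝ) ≤ Z ∧ Z < x ^ (1 / 2 : ℝ)) → (∀ q, 0 ≤ cq q ∧ cq q ≤ 1) →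
        (∀ q, q ∉ T → cq q = 0) →
        (∀ q ∈ T, 1 ≤ q ∧ (q : ℝ) < x ^ (1 - ε) ∧ q.Coprime (primesProdBelow Z)) →
        densityProdG a b c (x ^ (1 / 5 : ℝ)) * x *
            (∑ q ∈ T, cq q * (rhoG a b c q : ℝ) / q *
                f (Real.log (x ^ (16 / 15 : ℝ) / q) / Real.log Z) *
                  (Real.log (x ^ (1 / 5 : ℝ)) / Real.log Z) - Cl * ε) ≤
          ∑ q ∈ T, cq q * (siftedCountG a b c x q Z : ℝ) := by
  obtain ⟨Cl, hCl⟩ := h2l F f hFf (1 / 5) (by norm_num) (by norm_num)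
  refine ⟨Cl, fun ε hε => ?_⟩
  obtain ⟨x₀, hx₀⟩ := hCl ε hε
  refine ⟨x₀, fun x hx T Z cq hZ hc hcT hT => ?_⟩
  have h := hx₀ x hx Z cq hZ hc
  simp only [] at h
  have hTQ : T ⊆ (Finset.Ico 1 ⌈x ^ (1 - ε)⌉₊).filter
      fun q : ℕ => q.Coprime (primesProdBelow Z) :=
    fun q hq => mem_propQ (zq := fun _ => Z) (hT q hq).1 (hT q hq).2.1 (hT q hq).2.2
  rw [sum_filter_support hTQ (fun q hq => by rw [hcT q hq]; simp),
    sum_filter_support hTQ (fun q hq => by rw [hcT q hq]; simp)] at h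
  exact h

end Families

/-! ### Elementary facts on `ρ_G`, `S(𝒜_q, ·)` -/

/-- `ρ_G(1) = 1`. [folklore] -/
theorem rhoG_one (a b c : ℤ) : rhoG a b c 1 = 1 := by
  rw [rhoG, polyRootCountMod, Finset.filter_true_of_mem (fun n _ => by simp), Finset.card_range]

open scoped Classical in
/-- `S(𝒜_q, ·)` is antitone in the sieving level: `z ≤ u ⟹ S(𝒜_q, u) ≤ S(𝒜_q, z)`. [folklore] -/
theorem siftedCountG_anti (x : ℝ) (q : ℕ) {z u : ℝ} (hzu : z ≤ u) :
    siftedCountG a b c x q u ≤ siftedCountG a b c x q z := by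
  unfold siftedCountG
  refine Finset.card_le_card (Finset.monotone_filter_right _ fun n _ hn => ?_)
  refine ⟨hn.1, ?_⟩
  rw [coprime_primesProdBelow_iff_forall] at hn ⊢
  exact fun r hr hrd => hzu.trans (hn.2 r hr hrd)

/-! ### Partial summation for `ρ_G`: prime sums → integrals (p. 186) -/

section LimitsG

/-- The weight `ρ_G(k)/k` on primes (`0` elsewhere). [folklore] -/
def rhoWeightG (a b c : ℤ) (k : ℕ) : ℝ := if k.Prime then (rhoG a b c k : ℝ) / k else 0

/-- `ρ_G(k)[k prime]/k ≥ 0`. [folklore] -/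
theorem rhoWeightG_nonneg (k : ℕ) : 0 ≤ rhoWeightG a b c k := by
  unfold rhoWeightG; split_ifs <;> positivity

/-- `ρ_G(k)[k prime]/k ≤ 2/k` (Iwaniec's hypotheses on `G`). [folklore] -/
theorem rhoWeightG_le (ha : 0 < a) (hc : Odd c) (hirr : Irreducible (quadPoly a b c)) (k : ℕ) :
    rhoWeightG a b c k ≤ 2 / k := by
  unfold rhoWeightG
  split_ifs with h
  · exact div_le_div_of_nonneg_right (by exact_mod_cast rhoG_le_two ha hc hirr h)
      (Nat.cast_nonneg _)
  · positivity

/-- The partial sums of `rhoWeightG` are `∑_{p ≤ t} ρ_G(p)/p`. [folklore] -/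
theorem psum_rhoWeightG (t : ℝ) :
    psum (rhoWeightG a b c) t = ∑ p ∈ Nat.primesLE ⌊t⌋₊, (rhoG a b c p : ℝ) / p := by
  rw [psum, Nat.primesLE, Nat.primesBelow, Finset.sum_filter, Finset.range_eq_Ico,
    ← Finset.Ico_succ_right_eq_Icc]
  rfl

/-- **Prime sums → integrals (limit form) for `ρ_G`.** For `g ∈ C¹[α, β]`, `0 < α ≤ β`:
`∑_{x^α < k ≤ x^β} g(log k/log x) ρ_G(k)[k prime]/k → ∫_α^β g(u) du/u` (p. 186, "if we replace
sums by integrals, as we can do by partial summation"), from `rhoMertensG`.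
[cite: IwaniecInventiones1978, §6 p. 186] -/
theorem tendsto_sum_Ioc_rhoWeightG (ha : 0 < a) (hc : Odd c)
    (hirr : Irreducible (quadPoly a b c)) {α β : ℝ} (hα : 0 < α) (hαβ : α ≤ β)
    {g g' : ℝ → ℝ} (hg : ∀ u ∈ Set.Icc α β, HasDerivAt g (g' u) u)
    (hg' : ContinuousOn g' (Set.Icc α β)) :
    Tendsto (fun x : ℝ => ∑ k ∈ Finset.Ioc ⌊x ^ α⌋₊ ⌊x ^ β⌋₊,
        g (Real.log k / Real.log x) * rhoWeightG a b c k) atTop (𝓝 (∫ u in α..β, g u / u)) := by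
  obtain ⟨b₀, hb⟩ := rhoMertensG ha hc hirr
  set E : ℝ → ℝ := fun t => psum (rhoWeightG a b c) t - Real.log (Real.log t) - b₀ with hEdef
  have hE : ∀ t : ℝ, 1 < t → psum (rhoWeightG a b c) t = Real.log (Real.log t) + b₀ + E t :=
    fun t _ => by simp only [hEdef]; ring
  have hE0 : Tendsto E atTop (𝓝 0) := by
    have h1 := hb.sub_const b₀
    rw [sub_self] at h1
    refine h1.congr' (Eventually.of_forall fun t => ?_)
    simp only [hEdef, psum_rhoWeightG]
  set K := |g α| + |g β| + ∫ u in α..β, |g' u| with hK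
  have hK0 : 0 ≤ K := by
    have : 0 ≤ ∫ u in α..β, |g' u| := intervalIntegral.integral_nonneg hαβ fun u _ => abs_nonneg _
    positivity
  rw [Metric.tendsto_nhds]
  intro δ hδ
  have hδ' : 0 < δ / (K + 1) := by positivity
  obtain ⟨T₀, hT₀⟩ := (Metric.tendsto_atTop.mp hE0) (δ / (K + 1)) hδ'
  filter_upwards [eventually_gt_atTop (1 : ℝ), (tendsto_rpow_atTop hα).eventually_ge_atTop T₀]
    with x hx1 hxT
  have hbound := abs_sum_mul_sub_integral_le (c := rhoWeightG a b c) hE hx1 hα hαβ hg hg'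
    (δ := δ / (K + 1)) (fun t ht _ => by
      have := hT₀ t (hxT.trans ht)
      rw [Real.dist_eq, sub_zero] at this
      exact this.le)
  rw [Real.dist_eq]
  calc |∑ k ∈ Finset.Ioc ⌊x ^ α⌋₊ ⌊x ^ β⌋₊, g (Real.log k / Real.log x) * rhoWeightG a b c k -
        ∫ u in α..β, g u / u| ≤ K * (δ / (K + 1)) := hbound
    _ < δ := by
      rw [mul_div_assoc']
      rw [div_lt_iff₀ (by positivity)]
      nlinarith

/-- **Endpoint comparison for `ρ_G`.** For `0 < A ≤ B` and `h ≥ 0` on `(⌊A⌋, ⌊B⌋]`, bounded by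
`H` on the primes of `[A, B)`:
`∑_{A ≤ p < B} (ρ_G(p)/p) h(p) ≤ ∑_{A < k ≤ B} ρ_G(k)[k prime]/k · h(k) + 2H/A`. [folklore] -/
theorem sum_primesIn_le_sum_IocG (ha : 0 < a) (hc : Odd c)
    (hirr : Irreducible (quadPoly a b c)) {A B : ℝ} (hA : 0 < A) {h : ℕ → ℝ} {H : ℝ}
    (hH : 0 ≤ H) (hh0 : ∀ k ∈ Finset.Ioc ⌊A⌋₊ ⌊B⌋₊, 0 ≤ h k)
    (hhH : ∀ p ∈ primesIn A B, h p ≤ H) :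
    ∑ p ∈ primesIn A B, (rhoG a b c p : ℝ) / p * h p ≤
      ∑ k ∈ Finset.Ioc ⌊A⌋₊ ⌊B⌋₊, rhoWeightG a b c k * h k + 2 * H / A := by
  rw [← Finset.sum_filter_add_sum_filter_not (primesIn A B) (fun p : ℕ => A < (p : ℝ))]
  refine add_le_add ?_ ?_
  · have hsub : (primesIn A B).filter (fun p : ℕ => A < (p : ℝ)) ⊆ Finset.Ioc ⌊A⌋₊ ⌊B⌋₊ := by
      intro p hp
      rw [Finset.mem_filter, mem_primesIn] at hp
      rw [Finset.mem_Ioc]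
      exact ⟨(Nat.floor_lt hA.le).mpr hp.2, Nat.le_floor hp.1.2.2.le⟩
    have heq : ∀ p ∈ (primesIn A B).filter (fun p : ℕ => A < (p : ℝ)),
        (rhoG a b c p : ℝ) / p * h p = rhoWeightG a b c p * h p := by
      intro p hp
      rw [Finset.mem_filter, mem_primesIn] at hp
      rw [rhoWeightG, if_pos hp.1.1]
    rw [Finset.sum_congr rfl heq]
    exact Finset.sum_le_sum_of_subset_of_nonneg hsub fun k hk _ =>
      mul_nonneg (rhoWeightG_nonneg k) (hh0 k hk)
  · have hsub : (primesIn A B).filter (fun p : ℕ => ¬ A < (p : ℝ)) ⊆ {⌊A⌋₊} := by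
      intro p hp
      rw [Finset.mem_filter, mem_primesIn, not_lt] at hp
      rw [Finset.mem_singleton]
      have : (p : ℝ) = A := le_antisymm hp.2 hp.1.2.1
      rw [← this, Nat.floor_natCast]
    calc ∑ p ∈ (primesIn A B).filter (fun p : ℕ => ¬ A < (p : ℝ)), (rhoG a b c p : ℝ) / p * h p
        ≤ ∑ p ∈ ({⌊A⌋₊} : Finset ℕ), (if p ∈ (primesIn A B).filter (fun p : ℕ => ¬ A < (p : ℝ))
            then (rhoG a b c p : ℝ) / p * h p else 0) := by
          rw [← Finset.sum_filter, Finset.filter_mem_eq_inter, Finset.inter_eq_right.mpr hsub]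
      _ ≤ 2 * H / A := by
          rw [Finset.sum_singleton]
          split_ifs with hmem
          · rw [Finset.mem_filter, mem_primesIn, not_lt] at hmem
            have hpA : ((⌊A⌋₊ : ℕ) : ℝ) = A := le_antisymm hmem.2 hmem.1.2.1
            have hprime := hmem.1.1
            have hρ : (rhoG a b c ⌊A⌋₊ : ℝ) ≤ 2 := by
              exact_mod_cast rhoG_le_two ha hc hirr hprime
            have hhp : h ⌊A⌋₊ ≤ H := hhH _ (mem_primesIn.mpr hmem.1)
            have hh0' : 0 ≤ h ⌊A⌋₊ ∨ h ⌊A⌋₊ < 0 := le_or_gt 0 _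
            rw [hpA]
            rcases hh0' with h0 | h0
            · calc (rhoG a b c ⌊A⌋₊ : ℝ) / A * h ⌊A⌋₊ ≤ 2 / A * H := by gcongr
                _ = 2 * H / A := by ring
            · calc (rhoG a b c ⌊A⌋₊ : ℝ) / A * h ⌊A⌋₊ ≤ 0 :=
                    mul_nonpos_of_nonneg_of_nonpos (by positivity) h0.le
                _ ≤ 2 * H / A := by positivity
          · positivity

/-- `psum c B − psum c A = ∑_{⌊A⌋ < k ≤ ⌊B⌋} c_k` for `A ≤ B`. [folklore] -/
theorem psum_sub_psum (cf : ℕ → ℝ) {A B : ℝ} (hAB : A ≤ B) :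
    psum cf B - psum cf A = ∑ k ∈ Finset.Ioc ⌊A⌋₊ ⌊B⌋₊, cf k := by
  have hfl : ⌊A⌋₊ ≤ ⌊B⌋₊ := Nat.floor_le_floor hAB
  rw [psum, psum, ← Finset.Ico_add_one_right_eq_Icc, ← Finset.Ico_add_one_right_eq_Icc,
    ← Finset.Ico_add_one_add_one_eq_Ioc,
    ← Finset.sum_Ico_consecutive cf (Nat.zero_le _) (Nat.add_le_add_right hfl 1)]
  ring

/-- `∑_{A ≤ p < B} ρ_G(p)/p ≤ A(B) − A(A) + 2/A` with `A(t) = ∑_{p ≤ t} ρ_G(p)/p` (`0 < A ≤ B`).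
[folklore] -/
theorem sum_primesIn_rhoG_div_le_psum (ha : 0 < a) (hc : Odd c)
    (hirr : Irreducible (quadPoly a b c)) {A B : ℝ} (hA : 0 < A) (hAB : A ≤ B) :
    ∑ p ∈ primesIn A B, (rhoG a b c p : ℝ) / p ≤
      psum (rhoWeightG a b c) B - psum (rhoWeightG a b c) A + 2 / A := by
  have h := sum_primesIn_le_sum_IocG ha hc hirr (A := A) (B := B) hA (h := fun _ => (1 : ℝ))
    (H := 1) zero_le_one (fun _ _ => zero_le_one) (fun _ _ => le_rfl)
  simp only [mul_one] at h
  rw [psum_sub_psum _ hAB]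
  linarith

/-- `∑_{A ≤ p < B} ρ_G(p)/p ≥ 0`. [folklore] -/
theorem sum_primesIn_rhoG_div_nonneg (A B : ℝ) :
    0 ≤ ∑ p ∈ primesIn A B, (rhoG a b c p : ℝ) / p :=
  Finset.sum_nonneg fun _ _ => by positivity

/-- **`∑_{x^{1/5} ≤ p < x} ρ_G(p)/p ≤ 3` for all large `x`** (the limit is `log 5 < 2`, by
`rhoMertensG`). [folklore] -/
theorem eventually_sum_primesIn_rhoG_div_le_three (ha : 0 < a) (hc : Odd c)
    (hirr : Irreducible (quadPoly a b c)) :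
    ∀ᶠ x : ℝ in atTop, ∑ p ∈ primesIn (x ^ (1 / 5 : ℝ)) x, (rhoG a b c p : ℝ) / p ≤ 3 := by
  obtain ⟨b₀, hb⟩ := rhoMertensG ha hc hirr
  set E : ℝ → ℝ := fun t => psum (rhoWeightG a b c) t - Real.log (Real.log t) - b₀ with hEdef
  have hE0 : Tendsto E atTop (𝓝 0) := by
    have h1 := hb.sub_const b₀
    rw [sub_self] at h1
    refine h1.congr' (Eventually.of_forall fun t => ?_)
    simp only [hEdef, psum_rhoWeightG]
  have hEz : Tendsto (fun x : ℝ => E (x ^ (1 / 5 : ℝ))) atTop (𝓝 0) :=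
    hE0.comp (tendsto_rpow_atTop (by norm_num))
  have h14 : Set.Iio (1 / 4 : ℝ) ∈ 𝓝 (0 : ℝ) := Iio_mem_nhds (by norm_num)
  have hm14 : Set.Ioi (-(1 / 4) : ℝ) ∈ 𝓝 (0 : ℝ) := Ioi_mem_nhds (by norm_num)
  have hinv : Tendsto (fun x : ℝ => 2 / x ^ (1 / 5 : ℝ)) atTop (𝓝 0) := by
    have := (tendsto_rpow_atTop (by norm_num : (0 : ℝ) < 1 / 5)).inv_tendsto_atTop.const_mul 2
    simpa [div_eq_mul_inv] using this
  filter_upwards [hE0.eventually h14, hEz.eventually hm14, hinv.eventually h14,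
    eventually_gt_atTop (1 : ℝ)] with x hEx hEzx hix hx1
  have hx0 : 0 < x := by linarith
  set z := x ^ (1 / 5 : ℝ) with hz
  have hz0 : 0 < z := by positivity
  have hzx : z ≤ x := by
    conv_rhs => rw [← Real.rpow_one x]
    exact Real.rpow_le_rpow_of_exponent_le hx1.le (by norm_num)
  have hsum := sum_primesIn_rhoG_div_le_psum ha hc hirr hz0 hzx
  have hlog : Real.log (Real.log x) - Real.log (Real.log z) = Real.log 5 := by
    have hL : 0 < Real.log x := Real.log_pos hx1
    rw [hz, Real.log_rpow hx0, ← Real.log_div hL.ne' (by positivity)]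
    congr 1
    field_simp
  have hlog5 : Real.log 5 < 2 := by
    rw [Real.log_lt_iff_lt_exp (by norm_num)]
    have h1 := Real.exp_one_gt_d9
    have : Real.exp 2 = Real.exp 1 * Real.exp 1 := by rw [← Real.exp_add]; norm_num
    nlinarith
  have hpsum : psum (rhoWeightG a b c) x - psum (rhoWeightG a b c) z =
      E x - E z + (Real.log (Real.log x) - Real.log (Real.log z)) := by
    simp only [hEdef]; ring
  linarith

/-- **`∑_{x^{1/2} ≤ p < (Kx)^{1/2}} ρ_G(p)/p → 0`** (`K ≥ 1` fixed): by `rhoMertensG` the sum is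
`log(1 + log K/log x) + o(1)`. [folklore] -/
theorem eventually_sum_primesIn_sqrt_rhoG_div_le (ha : 0 < a) (hc : Odd c)
    (hirr : Irreducible (quadPoly a b c)) {K : ℝ} (hK : 1 ≤ K) {δ : ℝ} (hδ : 0 < δ) :
    ∀ᶠ x : ℝ in atTop,
      ∑ p ∈ primesIn (x ^ (1 / 2 : ℝ)) ((K * x) ^ (1 / 2 : ℝ)), (rhoG a b c p : ℝ) / p ≤ δ := by
  obtain ⟨b₀, hb⟩ := rhoMertensG ha hc hirr
  set E : ℝ → ℝ := fun t => psum (rhoWeightG a b c) t - Real.log (Real.log t) - b₀ with hEdef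
  have hE0 : Tendsto E atTop (𝓝 0) := by
    have h1 := hb.sub_const b₀
    rw [sub_self] at h1
    refine h1.congr' (Eventually.of_forall fun t => ?_)
    simp only [hEdef, psum_rhoWeightG]
  have hK0 : 0 < K := by linarith
  have hw : Tendsto (fun x : ℝ => x ^ (1 / 2 : ℝ)) atTop atTop := tendsto_rpow_atTop (by norm_num)
  have hW : Tendsto (fun x : ℝ => (K * x) ^ (1 / 2 : ℝ)) atTop atTop :=
    (tendsto_rpow_atTop (by norm_num)).comp (Tendsto.const_mul_atTop hK0 tendsto_id)
  have hEw : Tendsto (fun x : ℝ => E (x ^ (1 / 2 : ℝ))) atTop (𝓝 0) := hE0.comp hw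
  have hEW : Tendsto (fun x : ℝ => E ((K * x) ^ (1 / 2 : ℝ))) atTop (𝓝 0) := hE0.comp hW
  have hinv : Tendsto (fun x : ℝ => 2 / x ^ (1 / 2 : ℝ)) atTop (𝓝 0) := by
    have := hw.inv_tendsto_atTop.const_mul 2
    simpa [div_eq_mul_inv] using this
  have hratio : Tendsto (fun x : ℝ => Real.log K / Real.log x) atTop (𝓝 0) := by
    have := Real.tendsto_log_atTop.inv_tendsto_atTop.const_mul (Real.log K)
    simpa [div_eq_mul_inv] using this
  have hd4 : Set.Iio (δ / 4) ∈ 𝓝 (0 : ℝ) := Iio_mem_nhds (by positivity)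
  have hmd4 : Set.Ioi (-(δ / 4)) ∈ 𝓝 (0 : ℝ) := Ioi_mem_nhds (by linarith)
  filter_upwards [hEW.eventually hd4, hEw.eventually hmd4, hinv.eventually hd4,
    hratio.eventually hd4, eventually_gt_atTop (1 : ℝ)] with x hEWx hEwx hix hrx hx1
  have hx0 : 0 < x := by linarith
  set w := x ^ (1 / 2 : ℝ) with hwdef
  set W := (K * x) ^ (1 / 2 : ℝ) with hWdef
  have hw0 : 0 < w := by positivity
  have hwW : w ≤ W := Real.rpow_le_rpow hx0.le (by nlinarith) (by norm_num)
  have hsum := sum_primesIn_rhoG_div_le_psum ha hc hirr hw0 hwW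
  have hL : 0 < Real.log x := Real.log_pos hx1
  have hLK : 0 ≤ Real.log K := Real.log_nonneg hK
  have hlog : Real.log (Real.log W) - Real.log (Real.log w) ≤ Real.log K / Real.log x := by
    have hlw : Real.log w = (1 / 2) * Real.log x := by rw [hwdef, Real.log_rpow hx0]
    have hlW : Real.log W = (1 / 2) * (Real.log K + Real.log x) := by
      rw [hWdef, Real.log_rpow (by positivity), Real.log_mul hK0.ne' hx0.ne']
    have hlw0 : 0 < Real.log w := by rw [hlw]; positivity
    have hlW0 : 0 < Real.log W := by rw [hlW]; positivity
    rw [← Real.log_div hlW0.ne' hlw0.ne']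
    have hq : Real.log W / Real.log w = 1 + Real.log K / Real.log x := by
      rw [hlW, hlw]; field_simp; ring
    rw [hq]
    have h1 : 0 < 1 + Real.log K / Real.log x := by positivity
    linarith [Real.log_le_sub_one_of_pos h1]
  have hpsum : psum (rhoWeightG a b c) W - psum (rhoWeightG a b c) w =
      E W - E w + (Real.log (Real.log W) - Real.log (Real.log w)) := by
    simp only [hEdef]; ring
  linarith

/-! ### The three prime sums of p. 186 for `ρ_G` are asymptotically at most `T3, T4, T5` -/

/-- **Bound for `M_B`, general `G`:** for `ρ_G` (by `rhoMertensG`), for every `δ > 0`,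
eventually
`M_B(x) ≤ ∫_{1/5}^{1/2} F(5(16/15 − u)) du + δ` (`= T4 + δ`; the term `∫ u F((α−u)/γ) du/u` of
p. 186). [cite: IwaniecInventiones1978, §6 p. 186] -/
theorem MB_leG (ha : 0 < a) (hc : Odd c) (hirr : Irreducible (quadPoly a b c))
    {F f : ℝ → ℝ} (h : IsLinearSieveFunctions F f) {δ : ℝ}
    (hδ : 0 < δ) :
    ∀ᶠ x : ℝ in atTop,
      ∑ p ∈ primesIn (x ^ (1 / 5 : ℝ)) (x ^ (1 / 2 : ℝ)),
          Real.log p / Real.log x * (rhoG a b c p : ℝ) / p *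
            F (Real.log (x ^ (16 / 15 : ℝ) / p) / Real.log (x ^ (1 / 5 : ℝ))) ≤
        (∫ u in (1 / 5 : ℝ)..(1 / 2), F (5 * (16 / 15 - u))) + δ := by
  set gB : ℝ → ℝ := fun v => v * F (5 * (16 / 15 - v)) with hgB
  -- `C¹` data on `[1/5, 1/2]`
  have hderiv : ∀ u ∈ Set.Icc (1 / 5 : ℝ) (1 / 2), HasDerivAt gB _ u := fun u hu =>
    hasDerivAt_gB h (by linarith [hu.2])
  have hcont' := (continuousOn_gB_deriv h).mono
    (show Set.Icc (1 / 5 : ℝ) (1 / 2) ⊆ Set.Iio (16 / 15) from fun u hu => by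
      simp only [Set.mem_Iio]; linarith [hu.2])
  -- a bound `H` for `|g_B|` on `[1/5, 1/2]`
  have hgBc : ContinuousOn gB (Set.Icc (1 / 5 : ℝ) (1 / 2)) :=
    fun u hu => (hderiv u hu).continuousAt.continuousWithinAt
  obtain ⟨H, hH⟩ := isCompact_Icc.exists_bound_of_continuousOn hgBc
  have hH0 : 0 ≤ H := le_trans (norm_nonneg _) (hH (1 / 5) ⟨le_rfl, by norm_num⟩)
  -- the limit of the `Ioc`-sums
  have hlim := tendsto_sum_Ioc_rhoWeightG ha hc hirr (by norm_num : (0 : ℝ) < 1 / 5)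
    (by norm_num : (1 / 5 : ℝ) ≤ 1 / 2) hderiv hcont'
  have hint : ∫ u in (1 / 5 : ℝ)..(1 / 2), gB u / u =
      ∫ u in (1 / 5 : ℝ)..(1 / 2), F (5 * (16 / 15 - u)) := by
    refine intervalIntegral.integral_congr fun u hu => ?_
    rw [Set.uIcc_of_le (by norm_num : (1 / 5 : ℝ) ≤ 1 / 2)] at hu
    have hu0 : u ≠ 0 := by linarith [hu.1]
    simp only [hgB]
    rw [mul_comm, mul_div_assoc, div_self hu0, mul_one]
  rw [hint] at hlim
  have hev1 := (Metric.tendsto_nhds.mp hlim) (δ / 2) (by positivity)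
  have hev2 : ∀ᶠ x : ℝ in atTop, 2 * H / x ^ (1 / 5 : ℝ) ≤ δ / 2 := by
    have ht : Tendsto (fun x : ℝ => 2 * H / x ^ (1 / 5 : ℝ)) atTop (𝓝 0) := by
      have := (tendsto_rpow_atTop (by norm_num : (0 : ℝ) < 1 / 5)).inv_tendsto_atTop.const_mul
        (2 * H)
      simpa [div_eq_mul_inv] using this
    exact (ht.eventually (Iic_mem_nhds (by positivity : (0 : ℝ) < δ / 2))).mono fun x hx => hx
  filter_upwards [hev1, hev2, eventually_gt_atTop (1 : ℝ)] with x hx1 hx2 hx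
  have hx0 : 0 < x := by linarith
  have hL0 : 0 < Real.log x := Real.log_pos hx
  have hz1 : 1 < x ^ (1 / 5 : ℝ) := Real.one_lt_rpow hx (by norm_num)
  -- rewrite the summand as `(ρ p / p) g_B(u_p)`
  have hsum : ∑ p ∈ primesIn (x ^ (1 / 5 : ℝ)) (x ^ (1 / 2 : ℝ)),
      Real.log p / Real.log x * (rhoG a b c p : ℝ) / p *
        F (Real.log (x ^ (16 / 15 : ℝ) / p) / Real.log (x ^ (1 / 5 : ℝ))) =
      ∑ p ∈ primesIn (x ^ (1 / 5 : ℝ)) (x ^ (1 / 2 : ℝ)),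
        (rhoG a b c p : ℝ) / p * gB (Real.log p / Real.log x) := by
    refine Finset.sum_congr rfl fun p hp => ?_
    have hpp := mem_primesIn.mp hp
    have hp0 : (0 : ℝ) < p := by exact_mod_cast hpp.1.pos
    have e : Real.log (x ^ (16 / 15 : ℝ) / p) / Real.log (x ^ (1 / 5 : ℝ)) =
        5 * (16 / 15 - Real.log p / Real.log x) := by
      rw [Real.log_div (by positivity) hp0.ne', Real.log_rpow hx0, Real.log_rpow hx0]
      field_simp
    rw [e, hgB]
    ring
  rw [hsum]
  -- endpoint comparison
  have hcmp := sum_primesIn_le_sum_IocG ha hc hirr (A := x ^ (1 / 5 : ℝ)) (B := x ^ (1 / 2 : ℝ))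
    (by positivity) (h := fun k : ℕ => gB (Real.log k / Real.log x)) hH0 ?_ ?_
  rotate_left
  · intro k hk
    rw [Finset.mem_Ioc] at hk
    have hk1 : x ^ (1 / 5 : ℝ) < k := (Nat.floor_lt (by positivity)).mp hk.1
    have hk2 : (k : ℝ) ≤ x ^ (1 / 2 : ℝ) := by
      have := Nat.floor_le (show 0 ≤ x ^ (1 / 2 : ℝ) by positivity)
      exact le_trans (by exact_mod_cast hk.2) this
    have hk0 : (0 : ℝ) < k := by linarith
    have hu1 : 1 / 5 < Real.log k / Real.log x := by
      rw [lt_div_iff₀ hL0, ← Real.log_rpow hx0]; exact Real.log_lt_log (by positivity) hk1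
    have hu2 : Real.log k / Real.log x ≤ 1 / 2 := by
      rw [div_le_iff₀ hL0, ← Real.log_rpow hx0]; exact Real.log_le_log hk0 hk2
    simp only [hgB]
    exact mul_nonneg (by linarith) (h.upper_nonneg (by linarith) (by linarith))
  · intro p hp
    have hpp := mem_primesIn.mp hp
    have hp0 : (0 : ℝ) < p := by exact_mod_cast hpp.1.pos
    have hu1 : 1 / 5 ≤ Real.log p / Real.log x := by
      rw [le_div_iff₀ hL0, ← Real.log_rpow hx0]; exact Real.log_le_log (by positivity) hpp.2.1
    have hu2 : Real.log p / Real.log x ≤ 1 / 2 := by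
      rw [div_le_iff₀ hL0, ← Real.log_rpow hx0]; exact Real.log_le_log hp0 hpp.2.2.le
    have := hH _ ⟨hu1, hu2⟩
    rw [Real.norm_eq_abs] at this
    exact (le_abs_self _).trans this
  -- combine
  have hIoc : ∑ k ∈ Finset.Ioc ⌊x ^ (1 / 5 : ℝ)⌋₊ ⌊x ^ (1 / 2 : ℝ)⌋₊,
      rhoWeightG a b c k * gB (Real.log k / Real.log x) ≤
      (∫ u in (1 / 5 : ℝ)..(1 / 2), F (5 * (16 / 15 - u))) + δ / 2 := by
    have := hx1
    rw [Real.dist_eq] at this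
    have h' : ∑ k ∈ Finset.Ioc ⌊x ^ (1 / 5 : ℝ)⌋₊ ⌊x ^ (1 / 2 : ℝ)⌋₊,
        rhoWeightG a b c k * gB (Real.log k / Real.log x) =
        ∑ k ∈ Finset.Ioc ⌊x ^ (1 / 5 : ℝ)⌋₊ ⌊x ^ (1 / 2 : ℝ)⌋₊,
          gB (Real.log k / Real.log x) * rhoWeightG a b c k := Finset.sum_congr rfl fun k _ => mul_comm _ _
    rw [h']
    linarith [(abs_lt.mp this).2]
  linarith [hcmp, hIoc, hx2]

/-- **Bound for `M_2`, general `G`:** for `ρ_G` (by `rhoMertensG`), for `0 < ε ≤ 1/4` and every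
`δ > 0`, eventually
`M_2(x, ε) ≤ ∫_{1/2}^{1−ε} (1 − u) F(5(16/15 − u)) du/u + δ` (the term
`∫_{1/2}^1 (1 − u) F((α−u)/γ) du/u` of p. 186). [cite: IwaniecInventiones1978, §6 p. 186] -/
theorem M2_leG (ha : 0 < a) (hc : Odd c) (hirr : Irreducible (quadPoly a b c))
    {F f : ℝ → ℝ} (h : IsLinearSieveFunctions F f) {ε δ : ℝ}
    (hε : 0 < ε) (hε4 : ε ≤ 1 / 4) (hδ : 0 < δ) :
    ∀ᶠ x : ℝ in atTop,
      ∑ p ∈ primesIn (x ^ (1 / 2 : ℝ)) (x ^ (1 - ε)),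
          (1 - Real.log p / Real.log x) * (rhoG a b c p : ℝ) / p *
            F (Real.log (x ^ (16 / 15 : ℝ) / p) / Real.log (x ^ (1 / 5 : ℝ))) ≤
        (∫ u in (1 / 2 : ℝ)..(1 - ε), (1 - u) * F (5 * (16 / 15 - u)) / u) + δ := by
  set g2 : ℝ → ℝ := fun v => (1 - v) * F (5 * (16 / 15 - v)) with hg2
  have hab : (1 / 2 : ℝ) ≤ 1 - ε := by linarith
  have hderiv : ∀ u ∈ Set.Icc (1 / 2 : ℝ) (1 - ε), HasDerivAt g2 _ u := fun u hu =>
    hasDerivAt_g2 h (by linarith [hu.2])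
  have hcont' := (continuousOn_g2_deriv h).mono
    (show Set.Icc (1 / 2 : ℝ) (1 - ε) ⊆ Set.Iio (16 / 15) from fun u hu => by
      simp only [Set.mem_Iio]; linarith [hu.2])
  have hg2c : ContinuousOn g2 (Set.Icc (1 / 2 : ℝ) (1 - ε)) :=
    fun u hu => (hderiv u hu).continuousAt.continuousWithinAt
  obtain ⟨H, hH⟩ := isCompact_Icc.exists_bound_of_continuousOn hg2c
  have hH0 : 0 ≤ H := le_trans (norm_nonneg _) (hH (1 / 2) ⟨le_rfl, hab⟩)
  have hlim := tendsto_sum_Ioc_rhoWeightG ha hc hirr (by norm_num : (0 : ℝ) < 1 / 2) hab hderiv hcont'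
  have hint : ∫ u in (1 / 2 : ℝ)..(1 - ε), g2 u / u =
      ∫ u in (1 / 2 : ℝ)..(1 - ε), (1 - u) * F (5 * (16 / 15 - u)) / u := by
    rfl
  rw [hint] at hlim
  have hev1 := (Metric.tendsto_nhds.mp hlim) (δ / 2) (by positivity)
  have hev2 : ∀ᶠ x : ℝ in atTop, 2 * H / x ^ (1 / 2 : ℝ) ≤ δ / 2 := by
    have ht : Tendsto (fun x : ℝ => 2 * H / x ^ (1 / 2 : ℝ)) atTop (𝓝 0) := by
      have := (tendsto_rpow_atTop (by norm_num : (0 : ℝ) < 1 / 2)).inv_tendsto_atTop.const_mul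
        (2 * H)
      simpa [div_eq_mul_inv] using this
    exact (ht.eventually (Iic_mem_nhds (by positivity : (0 : ℝ) < δ / 2))).mono fun x hx => hx
  filter_upwards [hev1, hev2, eventually_gt_atTop (1 : ℝ)] with x hx1 hx2 hx
  have hx0 : 0 < x := by linarith
  have hL0 : 0 < Real.log x := Real.log_pos hx
  have hsum : ∑ p ∈ primesIn (x ^ (1 / 2 : ℝ)) (x ^ (1 - ε)),
      (1 - Real.log p / Real.log x) * (rhoG a b c p : ℝ) / p *
        F (Real.log (x ^ (16 / 15 : ℝ) / p) / Real.log (x ^ (1 / 5 : ℝ))) =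
      ∑ p ∈ primesIn (x ^ (1 / 2 : ℝ)) (x ^ (1 - ε)),
        (rhoG a b c p : ℝ) / p * g2 (Real.log p / Real.log x) := by
    refine Finset.sum_congr rfl fun p hp => ?_
    have hpp := mem_primesIn.mp hp
    have hp0 : (0 : ℝ) < p := by exact_mod_cast hpp.1.pos
    have e : Real.log (x ^ (16 / 15 : ℝ) / p) / Real.log (x ^ (1 / 5 : ℝ)) =
        5 * (16 / 15 - Real.log p / Real.log x) := by
      rw [Real.log_div (by positivity) hp0.ne', Real.log_rpow hx0, Real.log_rpow hx0]
      field_simp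
    rw [e, hg2]
    ring
  rw [hsum]
  have hcmp := sum_primesIn_le_sum_IocG ha hc hirr (A := x ^ (1 / 2 : ℝ)) (B := x ^ (1 - ε))
    (by positivity) (h := fun k : ℕ => g2 (Real.log k / Real.log x)) hH0 ?_ ?_
  rotate_left
  · intro k hk
    rw [Finset.mem_Ioc] at hk
    have hk1 : x ^ (1 / 2 : ℝ) < k := (Nat.floor_lt (by positivity)).mp hk.1
    have hk2 : (k : ℝ) ≤ x ^ (1 - ε) := by
      have := Nat.floor_le (show 0 ≤ x ^ (1 - ε) by positivity)
      exact le_trans (by exact_mod_cast hk.2) this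
    have hk0 : (0 : ℝ) < k := by linarith [show (0:ℝ) < x ^ (1/2:ℝ) by positivity]
    have hu1 : 1 / 2 < Real.log k / Real.log x := by
      rw [lt_div_iff₀ hL0, ← Real.log_rpow hx0]; exact Real.log_lt_log (by positivity) hk1
    have hu2 : Real.log k / Real.log x ≤ 1 - ε := by
      rw [div_le_iff₀ hL0, ← Real.log_rpow hx0]; exact Real.log_le_log hk0 hk2
    simp only [hg2]
    exact mul_nonneg (by linarith) (h.upper_nonneg (by linarith) (by linarith))
  · intro p hp
    have hpp := mem_primesIn.mp hp
    have hp0 : (0 : ℝ) < p := by exact_mod_cast hpp.1.pos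
    have hu1 : 1 / 2 ≤ Real.log p / Real.log x := by
      rw [le_div_iff₀ hL0, ← Real.log_rpow hx0]; exact Real.log_le_log (by positivity) hpp.2.1
    have hu2 : Real.log p / Real.log x ≤ 1 - ε := by
      rw [div_le_iff₀ hL0, ← Real.log_rpow hx0]; exact Real.log_le_log hp0 hpp.2.2.le
    have := hH _ ⟨hu1, hu2⟩
    rw [Real.norm_eq_abs] at this
    exact (le_abs_self _).trans this
  have hIoc : ∑ k ∈ Finset.Ioc ⌊x ^ (1 / 2 : ℝ)⌋₊ ⌊x ^ (1 - ε)⌋₊,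
      rhoWeightG a b c k * g2 (Real.log k / Real.log x) ≤
      (∫ u in (1 / 2 : ℝ)..(1 - ε), (1 - u) * F (5 * (16 / 15 - u)) / u) + δ / 2 := by
    have := hx1
    rw [Real.dist_eq] at this
    have h' : ∑ k ∈ Finset.Ioc ⌊x ^ (1 / 2 : ℝ)⌋₊ ⌊x ^ (1 - ε)⌋₊,
        rhoWeightG a b c k * g2 (Real.log k / Real.log x) =
        ∑ k ∈ Finset.Ioc ⌊x ^ (1 / 2 : ℝ)⌋₊ ⌊x ^ (1 - ε)⌋₊,
          g2 (Real.log k / Real.log x) * rhoWeightG a b c k := Finset.sum_congr rfl fun k _ => mul_comm _ _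
    rw [h']
    linarith [(abs_lt.mp this).2]
  linarith [hcmp, hIoc, hx2]

/-- **Bound for `M_A`, general `G`:** for `ρ_G` (by `rhoMertensG`), for every `δ > 0`,
eventually
`M_A(x) ≤ ∫_{1/5}^{1/2} (1 − 2u) F((16/15 − u)/u) (1/5)/u du/u + δ` (`= T3 + δ`; the term
`∫ (1 − 2u)(γ/u) F((α−u)/u) du/u` of p. 186). [cite: IwaniecInventiones1978, §6 p. 186] -/
theorem MA_leG (ha : 0 < a) (hc : Odd c) (hirr : Irreducible (quadPoly a b c))
    {F f : ℝ → ℝ} (h : IsLinearSieveFunctions F f) {δ : ℝ}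
    (hδ : 0 < δ) :
    ∀ᶠ x : ℝ in atTop,
      ∑ p ∈ primesIn (x ^ (1 / 5 : ℝ)) (x ^ (1 / 2 : ℝ)),
          (1 - 2 * Real.log p / Real.log x) * (rhoG a b c p : ℝ) / p *
            F (Real.log (x ^ (16 / 15 : ℝ) / p) / Real.log p) *
              (Real.log (x ^ (1 / 5 : ℝ)) / Real.log p) ≤
        (∫ u in (1 / 5 : ℝ)..(1 / 2),
          (1 - 2 * u) * F ((16 / 15 - u) / u) * ((1 / 5) / u) / u) + δ := by
  set gA : ℝ → ℝ := fun v => (1 - 2 * v) * F ((16 / 15 - v) / v) * ((1 / 5) / v) with hgA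
  have hderiv : ∀ u ∈ Set.Icc (1 / 5 : ℝ) (1 / 2), HasDerivAt gA _ u := fun u hu =>
    hasDerivAt_gA h (by linarith [hu.1]) (by linarith [hu.2])
  have hcont' := (continuousOn_gA_deriv h).mono
    (show Set.Icc (1 / 5 : ℝ) (1 / 2) ⊆ Set.Ioo 0 (16 / 15) from fun u hu =>
      ⟨by linarith [hu.1], by linarith [hu.2]⟩)
  have hgAc : ContinuousOn gA (Set.Icc (1 / 5 : ℝ) (1 / 2)) :=
    fun u hu => (hderiv u hu).continuousAt.continuousWithinAt
  obtain ⟨H, hH⟩ := isCompact_Icc.exists_bound_of_continuousOn hgAc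
  have hH0 : 0 ≤ H := le_trans (norm_nonneg _) (hH (1 / 5) ⟨le_rfl, by norm_num⟩)
  have hlim := tendsto_sum_Ioc_rhoWeightG ha hc hirr (by norm_num : (0 : ℝ) < 1 / 5)
    (by norm_num : (1 / 5 : ℝ) ≤ 1 / 2) hderiv hcont'
  have hev1 := (Metric.tendsto_nhds.mp hlim) (δ / 2) (by positivity)
  have hev2 : ∀ᶠ x : ℝ in atTop, 2 * H / x ^ (1 / 5 : ℝ) ≤ δ / 2 := by
    have ht : Tendsto (fun x : ℝ => 2 * H / x ^ (1 / 5 : ℝ)) atTop (𝓝 0) := by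
      have := (tendsto_rpow_atTop (by norm_num : (0 : ℝ) < 1 / 5)).inv_tendsto_atTop.const_mul
        (2 * H)
      simpa [div_eq_mul_inv] using this
    exact (ht.eventually (Iic_mem_nhds (by positivity : (0 : ℝ) < δ / 2))).mono fun x hx => hx
  filter_upwards [hev1, hev2, eventually_gt_atTop (1 : ℝ)] with x hx1 hx2 hx
  have hx0 : 0 < x := by linarith
  have hL0 : 0 < Real.log x := Real.log_pos hx
  have hz1 : 1 < x ^ (1 / 5 : ℝ) := Real.one_lt_rpow hx (by norm_num)
  have hsum : ∑ p ∈ primesIn (x ^ (1 / 5 : ℝ)) (x ^ (1 / 2 : ℝ)),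
      (1 - 2 * Real.log p / Real.log x) * (rhoG a b c p : ℝ) / p *
        F (Real.log (x ^ (16 / 15 : ℝ) / p) / Real.log p) *
          (Real.log (x ^ (1 / 5 : ℝ)) / Real.log p) =
      ∑ p ∈ primesIn (x ^ (1 / 5 : ℝ)) (x ^ (1 / 2 : ℝ)),
        (rhoG a b c p : ℝ) / p * gA (Real.log p / Real.log x) := by
    refine Finset.sum_congr rfl fun p hp => ?_
    have hpp := mem_primesIn.mp hp
    have hp0 : (0 : ℝ) < p := by exact_mod_cast hpp.1.pos
    have hp1 : (1 : ℝ) < p := hz1.trans_le hpp.2.1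
    have hlogp : 0 < Real.log p := Real.log_pos hp1
    have e1 : Real.log (x ^ (16 / 15 : ℝ) / p) / Real.log p =
        (16 / 15 - Real.log p / Real.log x) / (Real.log p / Real.log x) := by
      rw [Real.log_div (by positivity) hp0.ne', Real.log_rpow hx0]
      field_simp
    have e2 : Real.log (x ^ (1 / 5 : ℝ)) / Real.log p = (1 / 5) / (Real.log p / Real.log x) := by
      rw [Real.log_rpow hx0]
      field_simp
    rw [e1, e2, hgA]
    ring
  rw [hsum]
  have hcmp := sum_primesIn_le_sum_IocG ha hc hirr (A := x ^ (1 / 5 : ℝ)) (B := x ^ (1 / 2 : ℝ))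
    (by positivity) (h := fun k : ℕ => gA (Real.log k / Real.log x)) hH0 ?_ ?_
  rotate_left
  · intro k hk
    rw [Finset.mem_Ioc] at hk
    have hk1 : x ^ (1 / 5 : ℝ) < k := (Nat.floor_lt (by positivity)).mp hk.1
    have hk2 : (k : ℝ) ≤ x ^ (1 / 2 : ℝ) := by
      have := Nat.floor_le (show 0 ≤ x ^ (1 / 2 : ℝ) by positivity)
      exact le_trans (by exact_mod_cast hk.2) this
    have hk0 : (0 : ℝ) < k := by linarith
    have hu1 : 1 / 5 < Real.log k / Real.log x := by
      rw [lt_div_iff₀ hL0, ← Real.log_rpow hx0]; exact Real.log_lt_log (by positivity) hk1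
    have hu2 : Real.log k / Real.log x ≤ 1 / 2 := by
      rw [div_le_iff₀ hL0, ← Real.log_rpow hx0]; exact Real.log_le_log hk0 hk2
    set u := Real.log k / Real.log x with hu
    simp only [hgA]
    have hφ1 : 0 < (16 / 15 - u) / u := div_pos (by linarith) (by linarith)
    have hφ2 : (16 / 15 - u) / u ≤ 5 := by
      rw [div_le_iff₀ (by linarith : (0:ℝ) < u)]; linarith
    exact mul_nonneg (mul_nonneg (by linarith) (h.upper_nonneg hφ1 hφ2)) (by positivity)
  · intro p hp
    have hpp := mem_primesIn.mp hp
    have hp0 : (0 : ℝ) < p := by exact_mod_cast hpp.1.pos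
    have hu1 : 1 / 5 ≤ Real.log p / Real.log x := by
      rw [le_div_iff₀ hL0, ← Real.log_rpow hx0]; exact Real.log_le_log (by positivity) hpp.2.1
    have hu2 : Real.log p / Real.log x ≤ 1 / 2 := by
      rw [div_le_iff₀ hL0, ← Real.log_rpow hx0]; exact Real.log_le_log hp0 hpp.2.2.le
    have := hH _ ⟨hu1, hu2⟩
    rw [Real.norm_eq_abs] at this
    exact (le_abs_self _).trans this
  have hIoc : ∑ k ∈ Finset.Ioc ⌊x ^ (1 / 5 : ℝ)⌋₊ ⌊x ^ (1 / 2 : ℝ)⌋₊,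
      rhoWeightG a b c k * gA (Real.log k / Real.log x) ≤
      (∫ u in (1 / 5 : ℝ)..(1 / 2), gA u / u) + δ / 2 := by
    have := hx1
    rw [Real.dist_eq] at this
    have h' : ∑ k ∈ Finset.Ioc ⌊x ^ (1 / 5 : ℝ)⌋₊ ⌊x ^ (1 / 2 : ℝ)⌋₊,
        rhoWeightG a b c k * gA (Real.log k / Real.log x) =
        ∑ k ∈ Finset.Ioc ⌊x ^ (1 / 5 : ℝ)⌋₊ ⌊x ^ (1 / 2 : ℝ)⌋₊,
          gA (Real.log k / Real.log x) * rhoWeightG a b c k := Finset.sum_congr rfl fun k _ => mul_comm _ _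
    rw [h']
    linarith [(abs_lt.mp this).2]
  have hint : ∫ u in (1 / 5 : ℝ)..(1 / 2), gA u / u =
      ∫ u in (1 / 5 : ℝ)..(1 / 2), (1 - 2 * u) * F ((16 / 15 - u) / u) * ((1 / 5) / u) / u := rfl
  rw [hint] at hIoc
  linarith [hcmp, hIoc, hx2]

end LimitsG

/-! ### §6 for general `G`: comparison of the `log X`-weighted main terms with those of `n² + 1` -/

section MainTermsG

/-- Monotonicity of `primesIn` in its endpoints. [folklore] -/
theorem primesIn_mono {a₁ a₂ b₁ b₂ : ℝ} (h₁ : a₂ ≤ a₁) (h₂ : b₁ ≤ b₂) :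
    primesIn a₁ b₁ ⊆ primesIn a₂ b₂ := fun p hp => by
  rw [mem_primesIn] at hp ⊢
  exact ⟨hp.1, h₁.trans hp.2.1, hp.2.2.trans_le h₂⟩

/-- Family `A` of p. 186 with the weights `1 − 2 log p/log X`, `log X = log K + log x ≥ log x`:
the main term exceeds the one with weights `1 − 2 log p/log x` by at most
`(log K/log x) H ∑_{z ≤ p < x^{1/2}} ρ_G(p)/p`, `H` a bound for `F` on `[1/3, 13/3]`
(`1 − 2l/(k + L) ≤ 1 − 2l/L + k/L` for `0 ≤ 2l ≤ L`, `k ≥ 0`). [folklore] -/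
theorem mainA_logX_le {F : ℝ → ℝ} {H lK x : ℝ} (hx : 1 < x) (hlK : 0 ≤ lK) (hH : 0 ≤ H)
    (hF0 : ∀ s : ℝ, 0 < s → s ≤ 5 → 0 ≤ F s)
    (hFH : ∀ s ∈ Set.Icc (1 / 3 : ℝ) (13 / 3), F s ≤ H) :
    ∑ p ∈ primesIn (x ^ (1 / 5 : ℝ)) (x ^ (1 / 2 : ℝ)),
        (1 - 2 * Real.log p / (lK + Real.log x)) * (rhoG a b c p : ℝ) / p *
          F (Real.log (x ^ (16 / 15 : ℝ) / p) / Real.log p) *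
            (Real.log (x ^ (1 / 5 : ℝ)) / Real.log p) ≤
      ∑ p ∈ primesIn (x ^ (1 / 5 : ℝ)) (x ^ (1 / 2 : ℝ)),
        (1 - 2 * Real.log p / Real.log x) * (rhoG a b c p : ℝ) / p *
          F (Real.log (x ^ (16 / 15 : ℝ) / p) / Real.log p) *
            (Real.log (x ^ (1 / 5 : ℝ)) / Real.log p) +
      lK / Real.log x * H *
        ∑ p ∈ primesIn (x ^ (1 / 5 : ℝ)) (x ^ (1 / 2 : ℝ)), (rhoG a b c p : ℝ) / p := by
  rw [Finset.mul_sum, ← Finset.sum_add_distrib]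
  refine Finset.sum_le_sum fun p hp => ?_
  obtain ⟨hpp, hzp, hpw⟩ := mem_primesIn.mp hp
  have hx0 : 0 < x := by linarith
  set L := Real.log x with hL
  have hL0 : 0 < L := Real.log_pos hx
  have hp0 : (0 : ℝ) < p := by exact_mod_cast hpp.pos
  set lp := Real.log (p : ℝ) with hlp
  have hlp1 : 1 / 5 * L ≤ lp := by
    have := Real.log_le_log (by positivity) hzp
    rwa [Real.log_rpow hx0] at this
  have hlp2 : lp < 1 / 2 * L := by
    have := Real.log_lt_log hp0 hpw
    rwa [Real.log_rpow hx0] at this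
  have hlp0 : 0 < lp := by linarith
  have esA : Real.log (x ^ (16 / 15 : ℝ) / p) / lp = (16 / 15 * L - lp) / lp := by
    rw [Real.log_div (by positivity) hp0.ne', Real.log_rpow hx0]
  have er : Real.log (x ^ (1 / 5 : ℝ)) / lp = (1 / 5 * L) / lp := by
    rw [Real.log_rpow hx0]
  rw [esA, er]
  set s := (16 / 15 * L - lp) / lp with hs
  set r := (1 / 5 * L) / lp with hr
  have hs0 : 0 < s := div_pos (by linarith) hlp0
  have hs5 : s ≤ 5 := by rw [hs, div_le_iff₀ hlp0]; linarith
  have hs13 : 1 / 3 ≤ s := by rw [hs, le_div_iff₀ hlp0]; linarith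
  have hs133 : s ≤ 13 / 3 := by rw [hs, div_le_iff₀ hlp0]; linarith
  have hFv0 : 0 ≤ F s := hF0 s hs0 hs5
  have hFvH : F s ≤ H := hFH s ⟨hs13, hs133⟩
  have hr0 : 0 ≤ r := by rw [hr]; positivity
  have hr1 : r ≤ 1 := by rw [hr, div_le_one hlp0]; linarith
  have hcX : 1 - 2 * lp / (lK + L) ≤ (1 - 2 * lp / L) + lK / L := by
    have hLX : 0 < lK + L := by linarith
    have key : (1 - 2 * lp / (lK + L)) - ((1 - 2 * lp / L) + lK / L) =
        lK * (2 * lp - (lK + L)) / (L * (lK + L)) := by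
      field_simp; ring
    have : lK * (2 * lp - (lK + L)) / (L * (lK + L)) ≤ 0 :=
      div_nonpos_of_nonpos_of_nonneg (mul_nonpos_of_nonneg_of_nonpos hlK (by linarith))
        (by positivity)
    linarith
  set ρp := (rhoG a b c p : ℝ) with hρp
  set Q := ρp / p * F s * r with hQ
  have hQ0 : 0 ≤ Q := by positivity
  have hQle : Q ≤ ρp / p * H := by
    have h1 : F s * r ≤ H * 1 := mul_le_mul hFvH hr1 hr0 hH
    calc Q = ρp / p * (F s * r) := by rw [hQ]; ring
      _ ≤ ρp / p * (H * 1) := mul_le_mul_of_nonneg_left h1 (by positivity)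
      _ = ρp / p * H := by ring
  have hlKL : 0 ≤ lK / L := by positivity
  calc (1 - 2 * lp / (lK + L)) * ρp / p * F s * r = (1 - 2 * lp / (lK + L)) * Q := by
        rw [hQ]; ring
    _ ≤ ((1 - 2 * lp / L) + lK / L) * Q := mul_le_mul_of_nonneg_right hcX hQ0
    _ = (1 - 2 * lp / L) * Q + lK / L * Q := by ring
    _ ≤ (1 - 2 * lp / L) * Q + lK / L * (ρp / p * H) := by gcongr
    _ = (1 - 2 * lp / L) * ρp / p * F s * r + lK / L * H * (ρp / p) := by rw [hQ]; ring

/-- Family `B` of p. 186: the weights `log p/log X ≤ log p/log x`. [folklore] -/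
theorem mainB_logX_le {F : ℝ → ℝ} {lK x : ℝ} (hx : 1 < x) (hlK : 0 ≤ lK)
    (hF0 : ∀ s : ℝ, 0 < s → s ≤ 5 → 0 ≤ F s) :
    ∑ p ∈ primesIn (x ^ (1 / 5 : ℝ)) (x ^ (1 / 2 : ℝ)),
        Real.log p / (lK + Real.log x) * (rhoG a b c p : ℝ) / p *
          F (Real.log (x ^ (16 / 15 : ℝ) / p) / Real.log (x ^ (1 / 5 : ℝ))) ≤
      ∑ p ∈ primesIn (x ^ (1 / 5 : ℝ)) (x ^ (1 / 2 : ℝ)),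
        Real.log p / Real.log x * (rhoG a b c p : ℝ) / p *
          F (Real.log (x ^ (16 / 15 : ℝ) / p) / Real.log (x ^ (1 / 5 : ℝ))) := by
  refine Finset.sum_le_sum fun p hp => ?_
  obtain ⟨hpp, hzp, hpw⟩ := mem_primesIn.mp hp
  have hx0 : 0 < x := by linarith
  have hp0 : (0 : ℝ) < p := by exact_mod_cast hpp.pos
  have hLne : Real.log x ≠ 0 := (Real.log_pos hx).ne'
  have es : Real.log (x ^ (16 / 15 : ℝ) / p) / Real.log (x ^ (1 / 5 : ℝ)) =
      5 * (16 / 15 - Real.log p / Real.log x) := by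
    rw [Real.log_div (by positivity) hp0.ne', Real.log_rpow hx0, Real.log_rpow hx0]
    field_simp
  rw [es]
  set L := Real.log x with hL
  have hL0 : 0 < L := Real.log_pos hx
  set lp := Real.log (p : ℝ) with hlp
  have hlp1 : 1 / 5 * L ≤ lp := by
    have := Real.log_le_log (by positivity) hzp
    rwa [Real.log_rpow hx0] at this
  have hlp2 : lp < 1 / 2 * L := by
    have := Real.log_lt_log hp0 hpw
    rwa [Real.log_rpow hx0] at this
  have hlp0 : 0 < lp := by linarith
  set s := 5 * (16 / 15 - lp / L) with hs
  have hu1 : 1 / 5 ≤ lp / L := by rw [le_div_iff₀ hL0]; linarith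
  have hu2 : lp / L ≤ 1 / 2 := by rw [div_le_iff₀ hL0]; linarith
  have hFv0 : 0 ≤ F s := hF0 s (by rw [hs]; linarith) (by rw [hs]; linarith)
  have hc : lp / (lK + L) ≤ lp / L :=
    div_le_div_of_nonneg_left hlp0.le hL0 (by linarith)
  set ρp := (rhoG a b c p : ℝ) with hρp
  calc lp / (lK + L) * ρp / p * F s = lp / (lK + L) * (ρp / p * F s) := by ring
    _ ≤ lp / L * (ρp / p * F s) := mul_le_mul_of_nonneg_right hc (by positivity)
    _ = lp / L * ρp / p * F s := by ring

/-- Family `2` of p. 186 (`z_q = z` on `[W', v)`, `x^{1/2} ≤ W'`, `v ≤ x`) with the weights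
`1 − log p/log X`: at most the `n² + 1`-shaped main term over `[x^{1/2}, v)` plus
`(log K/log x) H ∑_{W' ≤ p < v} ρ_G(p)/p` (`1 − l/(k + L) ≤ 1 − l/L + k/L` for `0 ≤ l ≤ k + L`).
[folklore] -/
theorem main2_logX_le {F : ℝ → ℝ} {H lK x W' v : ℝ} (hx : 1 < x) (hlK : 0 ≤ lK)
    (hF0 : ∀ s : ℝ, 0 < s → s ≤ 5 → 0 ≤ F s)
    (hFH : ∀ s ∈ Set.Icc (1 / 3 : ℝ) (13 / 3), F s ≤ H)
    (hW' : x ^ (1 / 2 : ℝ) ≤ W') (hv : v ≤ x) :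
    ∑ p ∈ primesIn W' v, (1 - Real.log p / (lK + Real.log x)) * (rhoG a b c p : ℝ) / p *
          F (Real.log (x ^ (16 / 15 : ℝ) / p) / Real.log (x ^ (1 / 5 : ℝ))) ≤
      ∑ p ∈ primesIn (x ^ (1 / 2 : ℝ)) v, (1 - Real.log p / Real.log x) * (rhoG a b c p : ℝ) / p *
          F (Real.log (x ^ (16 / 15 : ℝ) / p) / Real.log (x ^ (1 / 5 : ℝ))) +
      lK / Real.log x * H * ∑ p ∈ primesIn W' v, (rhoG a b c p : ℝ) / p := by
  have hx0 : 0 < x := by linarith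
  set L := Real.log x with hL
  have hL0 : 0 < L := Real.log_pos hx
  have hw0 : 0 < x ^ (1 / 2 : ℝ) := by positivity
  -- per-term facts on `[x^{1/2}, v)`
  have hterm : ∀ p ∈ primesIn (x ^ (1 / 2 : ℝ)) v,
      0 ≤ F (Real.log (x ^ (16 / 15 : ℝ) / p) / Real.log (x ^ (1 / 5 : ℝ))) ∧
        F (Real.log (x ^ (16 / 15 : ℝ) / p) / Real.log (x ^ (1 / 5 : ℝ))) ≤ H ∧
        0 ≤ 1 - Real.log p / L ∧ Real.log p ≤ L ∧ 0 ≤ Real.log p := by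
    intro p hp
    obtain ⟨hpp, hwp, hpv⟩ := mem_primesIn.mp hp
    have hp0 : (0 : ℝ) < p := by exact_mod_cast hpp.pos
    have hLne : Real.log x ≠ 0 := (Real.log_pos hx).ne'
    have es : Real.log (x ^ (16 / 15 : ℝ) / p) / Real.log (x ^ (1 / 5 : ℝ)) =
        5 * (16 / 15 - Real.log p / L) := by
      rw [hL, Real.log_div (by positivity) hp0.ne', Real.log_rpow hx0, Real.log_rpow hx0]
      field_simp
    rw [es]
    set lp := Real.log (p : ℝ) with hlp
    have hlp1 : 1 / 2 * L ≤ lp := by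
      have := Real.log_le_log hw0 hwp
      rwa [Real.log_rpow hx0] at this
    have hlp2 : lp ≤ L := Real.log_le_log hp0 (hpv.le.trans hv)
    have hu1 : 1 / 2 ≤ lp / L := by rw [le_div_iff₀ hL0]; linarith
    have hu2 : lp / L ≤ 1 := by rw [div_le_one hL0]; exact hlp2
    refine ⟨hF0 _ (by linarith) (by linarith), hFH _ ⟨by linarith, by linarith⟩,
      by linarith, hlp2, by linarith⟩
  have hsub : primesIn W' v ⊆ primesIn (x ^ (1 / 2 : ℝ)) v := primesIn_mono hW' le_rfl
  -- compare term by term on `[W', v)`, then enlarge the range of the first sum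
  have h1 : ∑ p ∈ primesIn W' v, (1 - Real.log p / (lK + L)) * (rhoG a b c p : ℝ) / p *
        F (Real.log (x ^ (16 / 15 : ℝ) / p) / Real.log (x ^ (1 / 5 : ℝ))) ≤
      ∑ p ∈ primesIn W' v, ((1 - Real.log p / L) * (rhoG a b c p : ℝ) / p *
        F (Real.log (x ^ (16 / 15 : ℝ) / p) / Real.log (x ^ (1 / 5 : ℝ))) +
          lK / L * H * ((rhoG a b c p : ℝ) / p)) := by
    refine Finset.sum_le_sum fun p hp => ?_
    obtain ⟨hF0p, hFHp, hc0, hlpL, hlp0⟩ := hterm p (hsub hp)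
    set lp := Real.log (p : ℝ) with hlp
    set Fv := F (Real.log (x ^ (16 / 15 : ℝ) / p) / Real.log (x ^ (1 / 5 : ℝ))) with hFv
    set ρp := (rhoG a b c p : ℝ) with hρp
    have hcX : 1 - lp / (lK + L) ≤ (1 - lp / L) + lK / L := by
      have hLX : 0 < lK + L := by linarith
      have key : (1 - lp / (lK + L)) - ((1 - lp / L) + lK / L) =
          lK * (lp - (lK + L)) / (L * (lK + L)) := by
        field_simp; ring
      have : lK * (lp - (lK + L)) / (L * (lK + L)) ≤ 0 :=
        div_nonpos_of_nonpos_of_nonneg (mul_nonpos_of_nonneg_of_nonpos hlK (by linarith))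
          (by positivity)
      linarith
    have hQ0 : 0 ≤ ρp / p * Fv := by positivity
    have hlKL : 0 ≤ lK / L := by positivity
    calc (1 - lp / (lK + L)) * ρp / p * Fv = (1 - lp / (lK + L)) * (ρp / p * Fv) := by ring
      _ ≤ ((1 - lp / L) + lK / L) * (ρp / p * Fv) := mul_le_mul_of_nonneg_right hcX hQ0
      _ = (1 - lp / L) * (ρp / p * Fv) + lK / L * (ρp / p * Fv) := by ring
      _ ≤ (1 - lp / L) * (ρp / p * Fv) + lK / L * (ρp / p * H) := by gcongr
      _ = (1 - lp / L) * ρp / p * Fv + lK / L * H * (ρp / p) := by ring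
  rw [Finset.sum_add_distrib, ← Finset.mul_sum] at h1
  have h2 : ∑ p ∈ primesIn W' v, (1 - Real.log p / L) * (rhoG a b c p : ℝ) / p *
        F (Real.log (x ^ (16 / 15 : ℝ) / p) / Real.log (x ^ (1 / 5 : ℝ))) ≤
      ∑ p ∈ primesIn (x ^ (1 / 2 : ℝ)) v, (1 - Real.log p / L) * (rhoG a b c p : ℝ) / p *
        F (Real.log (x ^ (16 / 15 : ℝ) / p) / Real.log (x ^ (1 / 5 : ℝ))) := by
    refine Finset.sum_le_sum_of_subset_of_nonneg hsub fun p hp _ => ?_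
    obtain ⟨hF0p, _, hc0, _, _⟩ := hterm p hp
    have : 0 ≤ (1 - Real.log p / L) * ((rhoG a b c p : ℝ) / p *
        F (Real.log (x ^ (16 / 15 : ℝ) / p) / Real.log (x ^ (1 / 5 : ℝ)))) :=
      mul_nonneg hc0 (by positivity)
    calc (0 : ℝ) ≤ _ := this
      _ = _ := by ring
  linarith

/-- The extra family of primes `x^{1/2} ≤ p < W'` (`log W' ≤ (9/16) log x`; in §6 for general
`G`, `W' = X^{1/2} = (Kx)^{1/2}`), sieved at `z = x^{1/5}` with weight `1`: its main term is at
most `H ∑_{x^{1/2} ≤ p < W'} ρ_G(p)/p`. [folklore] -/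
theorem mainN_le {F : ℝ → ℝ} {H x W' : ℝ} (hx : 1 < x)
    (hFH : ∀ s ∈ Set.Icc (1 / 3 : ℝ) (13 / 3), F s ≤ H)
    (hW' : Real.log W' ≤ 9 / 16 * Real.log x) :
    ∑ p ∈ primesIn (x ^ (1 / 2 : ℝ)) W', (rhoG a b c p : ℝ) / p *
          F (Real.log (x ^ (16 / 15 : ℝ) / p) / Real.log (x ^ (1 / 5 : ℝ))) ≤
      H * ∑ p ∈ primesIn (x ^ (1 / 2 : ℝ)) W', (rhoG a b c p : ℝ) / p := by
  rw [Finset.mul_sum]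
  refine Finset.sum_le_sum fun p hp => ?_
  obtain ⟨hpp, hwp, hpW⟩ := mem_primesIn.mp hp
  have hx0 : 0 < x := by linarith
  have hp0 : (0 : ℝ) < p := by exact_mod_cast hpp.pos
  have hLne : Real.log x ≠ 0 := (Real.log_pos hx).ne'
  have es : Real.log (x ^ (16 / 15 : ℝ) / p) / Real.log (x ^ (1 / 5 : ℝ)) =
      5 * (16 / 15 - Real.log p / Real.log x) := by
    rw [Real.log_div (by positivity) hp0.ne', Real.log_rpow hx0, Real.log_rpow hx0]
    field_simp
  rw [es]
  set L := Real.log x with hL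
  have hL0 : 0 < L := Real.log_pos hx
  set lp := Real.log (p : ℝ) with hlp
  have hlp1 : 1 / 2 * L ≤ lp := by
    have := Real.log_le_log (by positivity) hwp
    rwa [Real.log_rpow hx0] at this
  have hlp2 : lp < 9 / 16 * L := (Real.log_lt_log hp0 hpW).trans_le hW'
  have hu1 : 1 / 2 ≤ lp / L := by rw [le_div_iff₀ hL0]; linarith
  have hu2 : lp / L ≤ 9 / 16 := by rw [div_le_iff₀ hL0]; linarith
  have hFHp : F (5 * (16 / 15 - lp / L)) ≤ H := hFH _ ⟨by linarith, by linarith⟩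
  rw [mul_comm H]
  exact mul_le_mul_of_nonneg_left hFHp (by positivity)

end MainTermsG

/-! ### §6 assembled for general `G` -/

section AssemblyG

set_option maxHeartbeats 800000 in
open scoped Classical in
/-- **§6 assembled from Proposition 2 for `𝒜_G` (without the double sum) — PROVED.**  For
`0 < ε ≤ 1/8` and all large `x`, with `z = x^{1/5}`, `y = x^{16/15}`, `L = log x`:
`W(𝒜_G, z) ≥ V_G(z) x {f(16/3) − Σ_A − Σ_B − Σ₂ − C ε}` where
`Σ_A = ∑_{z ≤ p < x^{1/2}} (1 − 2 log p/L)(ρ_G(p)/p) F(log(y/p)/log p)(log z/log p)`,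
`Σ_B = ∑_{z ≤ p < x^{1/2}} (log p/L)(ρ_G(p)/p) F(log(y/p)/log z)`,
`Σ₂ = ∑_{x^{1/2} ≤ p < x^{1−ε}} (1 − log p/L)(ρ_G(p)/p) F(log(y/p)/log z)` — the same shape as
`weightedSum_ge_of_prop2_const` for `n² + 1`.  Proof: identity (3) at the size parameter
`X = Kx` (`weightedSumG_eq`; its double sum is dropped, being nonnegative); the first sum of (3)
over `z ≤ p < X^{1/2}` is split at `x^{1/2}` into the families `A` (`z_q = q`,
`c_q = 1 − 2 log q/log X`), `B` (`z_q = z`, `c_q = log q/log X`) and, on `x^{1/2} ≤ p < X^{1/2}`,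
an extra family (`z_q = z`, `c_q = 1`, using `S(𝒜_p, p) ≤ S(𝒜_p, z)`) whose main term is
`≤ H ∑_{x^{1/2} ≤ p < (Kx)^{1/2}} ρ_G(p)/p ≤ ε`; the last sum over `X^{1/2} ≤ p < X` is split at
`x^{1−ε}` into family `2` (`z_q = z`, `c_q = 1 − log q/log X`) and the tail, whose weights are
`≤ log K/log x + ε ≤ 2ε`, so that it is `≤ 8ε S(𝒜, z)` (`sum_siftedCountG_le_four_mul`); the
weights in `log X = log K + log x` exceed those in `log x` by `≤ log K/log x`, which costs
`≤ (log K/log x) H ∑_{z ≤ p < x} ρ_G(p)/p ≤ ε` (`mainA_logX_le`, `main2_logX_le`,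
`eventually_sum_primesIn_rhoG_div_le_three`); `S(𝒜, z)` is bounded below by the constant-level
lower half of Proposition 2 (`q = 1`).  `H` is a bound for `F` on `[1/3, 13/3]` and
`C = C_l + 4C_u + 8|f(16/3)| + 3`. [cite: IwaniecInventiones1978, §6 pp. 186–187] -/
theorem weightedSumG_ge_of_prop2G_const (ha : 0 < a) (hc : Odd c)
    (hirr : Irreducible (quadPoly a b c)) (h2u : proposition2G_upper a b c)
    (h2l : proposition2G_lower_const a b c) {F f : ℝ → ℝ} (hFf : IsLinearSieveFunctions F f) :
    ∃ C : ℝ, ∀ ε : ℝ, 0 < ε → ε ≤ 1 / 8 → ∀ᶠ x : ℝ in atTop,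
      densityProdG a b c (x ^ (1 / 5 : ℝ)) * x *
        (f (16 / 3)
          - ∑ p ∈ primesIn (x ^ (1 / 5 : ℝ)) (x ^ (1 / 2 : ℝ)),
              (1 - 2 * Real.log p / Real.log x) * (rhoG a b c p : ℝ) / p *
                F (Real.log (x ^ (16 / 15 : ℝ) / p) / Real.log p) *
                  (Real.log (x ^ (1 / 5 : ℝ)) / Real.log p)
          - ∑ p ∈ primesIn (x ^ (1 / 5 : ℝ)) (x ^ (1 / 2 : ℝ)),
              Real.log p / Real.log x * (rhoG a b c p : ℝ) / p *
                F (Real.log (x ^ (16 / 15 : ℝ) / p) / Real.log (x ^ (1 / 5 : ℝ)))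
          - ∑ p ∈ primesIn (x ^ (1 / 2 : ℝ)) (x ^ (1 - ε)),
              (1 - Real.log p / Real.log x) * (rhoG a b c p : ℝ) / p *
                F (Real.log (x ^ (16 / 15 : ℝ) / p) / Real.log (x ^ (1 / 5 : ℝ)))
          - C * ε) ≤
        weightedSumG a b c x (x ^ (1 / 5 : ℝ)) := by
  obtain ⟨Cu, hU⟩ := prop2G_upper_family h2u hFf
  obtain ⟨Cl, hLo⟩ := prop2G_lower_family_const h2l hFf
  set Cu' := max Cu 0 with hCu'
  set Cl' := max Cl 0 with hCl'
  have hCu0 : 0 ≤ Cu' := le_max_right _ _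
  have hCl0 : 0 ≤ Cl' := le_max_right _ _
  -- a bound `H` for `F` on `[1/3, 13/3]`, and `F ≥ 0` on `(0, 5]`
  obtain ⟨H₀, hH₀⟩ := isCompact_Icc.exists_bound_of_continuousOn
    (hFf.continuousOn_upper.mono (show Set.Icc (1 / 3 : ℝ) (13 / 3) ⊆ Set.Ioi 0 from
      fun s hs => by simp only [Set.mem_Ioi]; linarith [hs.1]))
  set H := max H₀ 0 with hHdef
  have hH0 : 0 ≤ H := le_max_right _ _
  have hFH : ∀ s ∈ Set.Icc (1 / 3 : ℝ) (13 / 3), F s ≤ H := fun s hs => by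
    have h1 := hH₀ s hs
    rw [Real.norm_eq_abs] at h1
    exact ((le_abs_self _).trans h1).trans (le_max_left _ _)
  have hF0 : ∀ s : ℝ, 0 < s → s ≤ 5 → 0 ≤ F s := fun s hs0 hs5 => hFf.upper_nonneg hs0 hs5
  -- the size constant `K` and `log K`
  set Kr : ℝ := (sizeK a b c : ℝ) with hKr
  have hK1 : 1 ≤ Kr := one_le_sizeK ha
  have hK0 : 0 < Kr := by linarith
  set lK := Real.log Kr with hlKdef
  have hlK0 : 0 ≤ lK := Real.log_nonneg hK1
  have hG : ∀ n : ℕ, gAbs a b c n ≠ 0 := fun n =>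
    Int.natAbs_ne_zero.mpr (quadPoly_eval_ne_zero ha.ne' hirr n)
  refine ⟨Cl' + 4 * Cu' + 8 * |f (16 / 3)| + 3, fun ε hε hε8 => ?_⟩
  obtain ⟨xu, hxu⟩ := hU ε hε
  obtain ⟨xl, hxl⟩ := hLo ε hε
  -- eventual conditions in `x`
  have hev1 : ∀ᶠ x : ℝ in atTop, (3 * H + 1) * lK / ε ≤ Real.log x :=
    Real.tendsto_log_atTop.eventually_ge_atTop _
  have hev2 := eventually_sum_primesIn_rhoG_div_le_three ha hc hirr
  have hev3 := eventually_sum_primesIn_sqrt_rhoG_div_le ha hc hirr hK1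
    (show 0 < ε / (H + 1) by positivity)
  filter_upwards [eventually_ge_atTop xu, eventually_ge_atTop xl, eventually_ge_atTop (2 : ℝ),
    eventually_ge_atTop (Kr ^ 2), hev1, hev2, hev3] with x hxu' hxl' hx2 hxK hxlog hR3 hRsq
  have hx1 : 1 < x := by linarith
  have hx0 : 0 < x := by linarith
  set L := Real.log x with hL
  have hL0 : 0 < L := Real.log_pos hx1
  -- thresholds `z < w ≤ W ≤ v ≤ x ≤ X`
  set z := x ^ (1 / 5 : ℝ) with hz
  set w := x ^ (1 / 2 : ℝ) with hw
  set X := Kr * x with hX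
  set W := X ^ (1 / 2 : ℝ) with hW
  set v := x ^ (1 - ε) with hv
  have hX1 : 1 ≤ X := one_le_mul_of_one_le_of_one_le hK1 hx1.le
  have hxX : x ≤ X := le_mul_of_one_le_left hx0.le hK1
  have hX0 : 0 < X := by linarith
  have hz1 : 1 < z := Real.one_lt_rpow hx1 (by norm_num)
  have hz0 : 0 < z := by linarith
  have hzw : z < w := Real.rpow_lt_rpow_of_exponent_lt hx1 (by norm_num)
  have hw0 : 0 < w := by linarith
  have hwW : w ≤ W := Real.rpow_le_rpow hx0.le hxX (by norm_num)
  have hWv : W ≤ v := by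
    have hKx : Kr ≤ w := by
      have e : Kr = (Kr ^ 2) ^ (1 / 2 : ℝ) := by
        rw [← Real.sqrt_eq_rpow, Real.sqrt_sq hK0.le]
      rw [e, hw]
      exact Real.rpow_le_rpow (by positivity) hxK (by norm_num)
    have h1 : X ≤ x ^ (3 / 2 : ℝ) := by
      rw [hX, show (3 / 2 : ℝ) = 1 / 2 + 1 by norm_num, Real.rpow_add hx0, Real.rpow_one]
      exact mul_le_mul_of_nonneg_right hKx hx0.le
    calc W = X ^ (1 / 2 : ℝ) := rfl
      _ ≤ (x ^ (3 / 2 : ℝ)) ^ (1 / 2 : ℝ) := Real.rpow_le_rpow hX0.le h1 (by norm_num)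
      _ = x ^ (3 / 4 : ℝ) := by rw [← Real.rpow_mul hx0.le]; norm_num
      _ ≤ v := Real.rpow_le_rpow_of_exponent_le hx1.le (by linarith)
  have hvx : v ≤ x := by
    conv_rhs => rw [← Real.rpow_one x]
    exact Real.rpow_le_rpow_of_exponent_le hx1.le (by linarith)
  have hvX : v ≤ X := hvx.trans hxX
  have h1v : (1 : ℝ) < v := Real.one_lt_rpow hx1 (by linarith)
  have hzW : z ≤ W := hzw.le.trans hwW
  have hwv : w ≤ v := hwW.trans hWv
  have hlogz : Real.log z = (1 / 5) * L := by rw [hz, Real.log_rpow hx0]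
  have hlogz0 : Real.log z ≠ 0 := by rw [hlogz]; positivity
  have hLX : Real.log ((sizeK a b c : ℝ) * x) = lK + L := Real.log_mul hK0.ne' hx0.ne'
  have hLXX : Real.log X = lK + L := hLX
  have hLX0 : 0 < lK + L := by linarith
  have hlogW : Real.log W = (1 / 2) * (lK + L) := by
    rw [hW, Real.log_rpow hX0, ← hLX]
  have hlogv : Real.log v = (1 - ε) * L := by rw [hv, Real.log_rpow hx0]
  have hlogw : Real.log w = (1 / 2) * L := by rw [hw, Real.log_rpow hx0]
  -- `log K ≤ ε log x`, and the smallness of the `log X → log x` perturbations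
  have hlKε : (3 * H + 1) * lK ≤ ε * L := by
    have h := hxlog; rw [div_le_iff₀ hε] at h; linarith
  have hHlK : 0 ≤ H * lK := mul_nonneg hH0 hlK0
  have hlKL : lK ≤ ε * L := by linarith
  have hpert : lK / L * H * 3 ≤ ε := by
    rw [show lK / L * H * 3 = 3 * H * lK / L by ring, div_le_iff₀ hL0]; linarith
  have hlogW' : Real.log W ≤ 9 / 16 * L := by
    have : ε * L ≤ 1 / 8 * L := mul_le_mul_of_nonneg_right hε8 hL0.le
    rw [hlogW]; linarith
  -- `V ≥ 0`
  set V := densityProdG a b c z * x with hVdef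
  have hV0 : 0 ≤ V := (mul_pos (densityProdG_pos ha hc hirr z) hx0).le
  -- index sets
  set P₁ := primesIn z w with hP₁
  set PN := primesIn w W with hPN
  set P₂ := primesIn W v with hP₂
  set P₃ := primesIn v X with hP₃
  -- abbreviations, sieve side
  set S₁ := (siftedCountG a b c x 1 z : ℝ) with hS₁
  set UA := ∑ p ∈ P₁, (1 - 2 * Real.log p / (lK + L)) * (siftedCountG a b c x p p : ℝ) with hUA
  set UB := ∑ p ∈ P₁, Real.log p / (lK + L) * (siftedCountG a b c x p z : ℝ) with hUB
  set UN := ∑ p ∈ PN, ((1 - 2 * Real.log p / (lK + L)) * (siftedCountG a b c x p p : ℝ)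
      + Real.log p / (lK + L) * (siftedCountG a b c x p z : ℝ)) with hUN
  set UN' := ∑ p ∈ PN, (siftedCountG a b c x p z : ℝ) with hUN'
  set U2 := ∑ p ∈ P₂, (1 - Real.log p / (lK + L)) * (siftedCountG a b c x p z : ℝ) with hU2
  set U3 := ∑ p ∈ P₃, (1 - Real.log p / (lK + L)) * (siftedCountG a b c x p z : ℝ) with hU3
  set D := ∑ p ∈ primesIn z W, ∑ p₁ ∈ primesIn z p,
      Real.log ((p : ℝ) / p₁) / (lK + L) * (siftedCountG a b c x (p * p₁) p₁ : ℝ) with hDdef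
  -- main terms with `log x` weights (the target) ...
  set MA := ∑ p ∈ P₁, (1 - 2 * Real.log p / L) * (rhoG a b c p : ℝ) / p *
      F (Real.log (x ^ (16 / 15 : ℝ) / p) / Real.log p) * (Real.log z / Real.log p) with hMA
  set MB := ∑ p ∈ P₁, Real.log p / L * (rhoG a b c p : ℝ) / p *
      F (Real.log (x ^ (16 / 15 : ℝ) / p) / Real.log z) with hMB
  set M2 := ∑ p ∈ primesIn w v, (1 - Real.log p / L) * (rhoG a b c p : ℝ) / p *
      F (Real.log (x ^ (16 / 15 : ℝ) / p) / Real.log z) with hM2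
  -- ... and with `log X` weights (what Proposition 2 produces), and the `ρ`-sums
  set MAX := ∑ p ∈ P₁, (1 - 2 * Real.log p / (lK + L)) * (rhoG a b c p : ℝ) / p *
      F (Real.log (x ^ (16 / 15 : ℝ) / p) / Real.log p) * (Real.log z / Real.log p) with hMAX
  set MBX := ∑ p ∈ P₁, Real.log p / (lK + L) * (rhoG a b c p : ℝ) / p *
      F (Real.log (x ^ (16 / 15 : ℝ) / p) / Real.log z) with hMBX
  set M2X := ∑ p ∈ P₂, (1 - Real.log p / (lK + L)) * (rhoG a b c p : ℝ) / p *
      F (Real.log (x ^ (16 / 15 : ℝ) / p) / Real.log z) with hM2X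
  set MN := ∑ p ∈ PN, (rhoG a b c p : ℝ) / p *
      F (Real.log (x ^ (16 / 15 : ℝ) / p) / Real.log z) with hMN
  set R₁ := ∑ p ∈ P₁, (rhoG a b c p : ℝ) / p with hR₁
  set R₂ := ∑ p ∈ P₂, (rhoG a b c p : ℝ) / p with hR₂
  set RN := ∑ p ∈ PN, (rhoG a b c p : ℝ) / p with hRN
  -- the main-term comparisons
  have hMAX : MAX ≤ MA + lK / L * H * R₁ := mainA_logX_le hx1 hlK0 hH0 hF0 hFH
  have hMBX : MBX ≤ MB := mainB_logX_le hx1 hlK0 hF0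
  have hM2X : M2X ≤ M2 + lK / L * H * R₂ := main2_logX_le hx1 hlK0 hF0 hFH hwW hvx
  have hMN : MN ≤ H * RN := mainN_le hx1 hFH hlogW'
  have hR₁ : R₁ ≤ 3 := le_trans (Finset.sum_le_sum_of_subset_of_nonneg
    (primesIn_mono le_rfl (hwv.trans hvx)) fun _ _ _ => by positivity) hR3
  have hR₂ : R₂ ≤ 3 := le_trans (Finset.sum_le_sum_of_subset_of_nonneg
    (primesIn_mono hzW hvx) fun _ _ _ => by positivity) hR3
  have hRN : H * RN ≤ ε := by
    have h1 : RN ≤ ε / (H + 1) := hRsq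
    have hRN0 : 0 ≤ RN := sum_primesIn_rhoG_div_nonneg _ _
    calc H * RN ≤ (H + 1) * RN := by linarith
      _ ≤ (H + 1) * (ε / (H + 1)) := by gcongr
      _ = ε := by field_simp
  have hMAX' : MAX ≤ MA + ε := by
    have : lK / L * H * R₁ ≤ lK / L * H * 3 := by gcongr
    linarith
  have hM2X' : M2X ≤ M2 + ε := by
    have : lK / L * H * R₂ ≤ lK / L * H * 3 := by gcongr
    linarith
  have hMN' : MN ≤ ε := hMN.trans hRN
  -- identity (3) and the splitting of its ranges
  have h3 := weightedSumG_eq (a := a) (b := b) (c := c) (x := x) (z := z) hG hX1 hzW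
  rw [hLX] at h3
  rw [sum_primesIn_split hzw.le hwW (fun p : ℕ =>
      ((1 - 2 * Real.log p / (lK + L)) * (siftedCountG a b c x p p : ℝ)
        + Real.log p / (lK + L) * (siftedCountG a b c x p z : ℝ))),
    sum_primesIn_split hWv hvX (fun p : ℕ =>
      (1 - Real.log p / (lK + L)) * (siftedCountG a b c x p z : ℝ))] at h3
  have hU1 : ∑ p ∈ P₁, ((1 - 2 * Real.log p / (lK + L)) * (siftedCountG a b c x p p : ℝ) +
      Real.log p / (lK + L) * (siftedCountG a b c x p z : ℝ)) = UA + UB := Finset.sum_add_distrib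
  rw [hU1] at h3
  -- the double sum is nonnegative
  have hD : 0 ≤ D := by
    refine Finset.sum_nonneg fun p hp => Finset.sum_nonneg fun p₁ hp₁ => ?_
    have hpp := (mem_primesIn.mp hp₁)
    have hp1pos : (0 : ℝ) < p₁ := by exact_mod_cast hpp.1.pos
    refine mul_nonneg (div_nonneg (Real.log_nonneg ?_) hLX0.le) (Nat.cast_nonneg _)
    rw [le_div_iff₀ hp1pos, one_mul]; exact hpp.2.2.le
  -- the tail `x^{1−ε} ≤ p < X`: weights `≤ 2ε`, at most four prime factors `≥ X^{1/2}`
  have htail : U3 ≤ 2 * ε * (4 * S₁) := by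
    have h1 : ∀ p ∈ P₃, (1 - Real.log p / (lK + L)) * (siftedCountG a b c x p z : ℝ) ≤
        2 * ε * siftedCountG a b c x p z := by
      intro p hp
      have hpp := mem_primesIn.mp hp
      refine mul_le_mul_of_nonneg_right ?_ (Nat.cast_nonneg _)
      have hp0 : (0 : ℝ) < p := by exact_mod_cast hpp.1.pos
      have hlpv : (1 - ε) * L ≤ Real.log p := by
        have := Real.log_le_log (by linarith) hpp.2.1; linarith
      have hεlK : 0 ≤ ε * lK := by positivity
      rw [sub_le_comm, le_div_iff₀ hLX0]
      linarith
    refine (Finset.sum_le_sum h1).trans ?_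
    rw [← Finset.mul_sum]
    exact mul_le_mul_of_nonneg_left (sum_siftedCountG_le_four_mul ha hirr hx1 hWv z)
      (by positivity)
  -- the extra family on `x^{1/2} ≤ p < X^{1/2}`: first `… ≤ S(𝒜_p, z)` termwise
  have hUN1 : UN ≤ UN' := by
    refine Finset.sum_le_sum fun p hp => ?_
    have hpp := mem_primesIn.mp hp
    have hp0 : (0 : ℝ) < p := by exact_mod_cast hpp.1.pos
    have hzp : z ≤ (p : ℝ) := hzw.le.trans hpp.2.1
    have hmono : (siftedCountG a b c x p p : ℝ) ≤ siftedCountG a b c x p z := by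
      exact_mod_cast siftedCountG_anti x p hzp
    have hlp0 : 0 ≤ Real.log p := Real.log_nonneg (by exact_mod_cast hpp.1.one_lt.le)
    have hlpW : 2 * Real.log p ≤ lK + L := by
      have := Real.log_lt_log hp0 hpp.2.2; linarith
    have hc1 : 0 ≤ 1 - 2 * Real.log p / (lK + L) := by
      rw [sub_nonneg, div_le_one hLX0]; exact hlpW
    have hc2 : 0 ≤ Real.log p / (lK + L) := by positivity
    have hS0 : (0 : ℝ) ≤ siftedCountG a b c x p z := Nat.cast_nonneg _
    have hsum : (1 - 2 * Real.log p / (lK + L)) + Real.log p / (lK + L) ≤ 1 := by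
      have e : (1 - 2 * Real.log p / (lK + L)) + Real.log p / (lK + L) =
          1 - Real.log p / (lK + L) := by ring
      rw [e]; linarith
    calc (1 - 2 * Real.log p / (lK + L)) * (siftedCountG a b c x p p : ℝ)
          + Real.log p / (lK + L) * (siftedCountG a b c x p z : ℝ)
        ≤ (1 - 2 * Real.log p / (lK + L)) * (siftedCountG a b c x p z : ℝ)
          + Real.log p / (lK + L) * (siftedCountG a b c x p z : ℝ) := by
            gcongr
      _ = ((1 - 2 * Real.log p / (lK + L)) + Real.log p / (lK + L)) *
            (siftedCountG a b c x p z : ℝ) := by ring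
      _ ≤ 1 * (siftedCountG a b c x p z : ℝ) := mul_le_mul_of_nonneg_right hsum hS0
      _ = (siftedCountG a b c x p z : ℝ) := one_mul _
  -- family A : `T = P₁`, `z_q = q`, `c_q = 1 − 2 log q / log X`
  have hA := hxu x hxu' P₁ (fun q => if q ∈ P₁ then (q : ℝ) else z)
    (fun q => if q ∈ P₁ then 1 - 2 * Real.log q / (lK + L) else 0) ?_ ?_ ?_ ?_
  rotate_left
  · intro q
    by_cases hq : q ∈ P₁
    · rw [if_pos hq]; exact ⟨(mem_primesIn.mp hq).2.1, (mem_primesIn.mp hq).2.2⟩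
    · rw [if_neg hq]; exact ⟨le_rfl, hzw⟩
  · intro q
    by_cases hq : q ∈ P₁
    · rw [if_pos hq]
      have hpp := mem_primesIn.mp hq
      have hq0 : (0 : ℝ) < q := by exact_mod_cast hpp.1.pos
      have hlog0 : 0 ≤ Real.log q := Real.log_nonneg (by exact_mod_cast hpp.1.one_lt.le)
      have hloglt : Real.log q < (1 / 2) * L := by
        have := Real.log_lt_log hq0 hpp.2.2; linarith
      constructor
      · rw [sub_nonneg, div_le_one hLX0]; linarith
      · rw [sub_le_self_iff]; positivity
    · rw [if_neg hq]; exact ⟨le_rfl, zero_le_one⟩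
  · intro q hq; rw [if_neg hq]
  · intro q hq
    have hpp := mem_primesIn.mp hq
    refine ⟨hpp.1.pos, hpp.2.2.trans_le hwv, ?_⟩
    rw [if_pos hq]
    exact prime_coprime_primesProdBelow hpp.1 le_rfl
  have hA' : UA ≤ V * (MAX + Cu * ε) := by
    refine le_of_eq_of_le ?_ (hA.trans (le_of_eq ?_))
    · exact Finset.sum_congr rfl fun q hq => by simp only [if_pos hq]
    · congr 2
      exact Finset.sum_congr rfl fun q hq => by simp only [if_pos hq, hz]
  -- family B : `T = P₁`, `z_q = z`, `c_q = log q / log X`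
  have hB := hxu x hxu' P₁ (fun _ => z)
    (fun q => if q ∈ P₁ then Real.log q / (lK + L) else 0) (fun _ => ⟨le_rfl, hzw⟩) ?_ ?_ ?_
  rotate_left
  · intro q
    by_cases hq : q ∈ P₁
    · rw [if_pos hq]
      have hpp := mem_primesIn.mp hq
      have hq0 : (0 : ℝ) < q := by exact_mod_cast hpp.1.pos
      have hlog0 : 0 ≤ Real.log q := Real.log_nonneg (by exact_mod_cast hpp.1.one_lt.le)
      have hloglt : Real.log q < (1 / 2) * L := by
        have := Real.log_lt_log hq0 hpp.2.2; linarith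
      exact ⟨div_nonneg hlog0 hLX0.le, by rw [div_le_one hLX0]; linarith⟩
    · rw [if_neg hq]; exact ⟨le_rfl, zero_le_one⟩
  · intro q hq; rw [if_neg hq]
  · intro q hq
    have hpp := mem_primesIn.mp hq
    exact ⟨hpp.1.pos, hpp.2.2.trans_le hwv, prime_coprime_primesProdBelow hpp.1 hpp.2.1⟩
  have hB' : UB ≤ V * (MBX + Cu * ε) := by
    refine le_of_eq_of_le ?_ (hB.trans (le_of_eq ?_))
    · exact Finset.sum_congr rfl fun q hq => by simp only [if_pos hq]
    · congr 2
      exact Finset.sum_congr rfl fun q hq => by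
        simp only [if_pos hq]; rw [div_self hlogz0, mul_one]
  -- the extra family N : `T = PN`, `z_q = z`, `c_q = 1`
  have hN := hxu x hxu' PN (fun _ => z)
    (fun q => if q ∈ PN then 1 else 0) (fun _ => ⟨le_rfl, hzw⟩) ?_ ?_ ?_
  rotate_left
  · intro q
    by_cases hq : q ∈ PN
    · rw [if_pos hq]; exact ⟨zero_le_one, le_rfl⟩
    · rw [if_neg hq]; exact ⟨le_rfl, zero_le_one⟩
  · intro q hq; rw [if_neg hq]
  · intro q hq
    have hpp := mem_primesIn.mp hq
    exact ⟨hpp.1.pos, hpp.2.2.trans_le hWv,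
      prime_coprime_primesProdBelow hpp.1 (hzw.le.trans hpp.2.1)⟩
  have hN' : UN' ≤ V * (MN + Cu * ε) := by
    refine le_of_eq_of_le ?_ (hN.trans (le_of_eq ?_))
    · exact Finset.sum_congr rfl fun q hq => by simp only [if_pos hq, one_mul]
    · congr 2
      exact Finset.sum_congr rfl fun q hq => by
        simp only [if_pos hq, one_mul]; rw [div_self hlogz0, mul_one]
  -- family 2 : `T = P₂`, `z_q = z`, `c_q = 1 − log q / log X`
  have hC2 := hxu x hxu' P₂ (fun _ => z)
    (fun q => if q ∈ P₂ then 1 - Real.log q / (lK + L) else 0) (fun _ => ⟨le_rfl, hzw⟩)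
    ?_ ?_ ?_
  rotate_left
  · intro q
    by_cases hq : q ∈ P₂
    · rw [if_pos hq]
      have hpp := mem_primesIn.mp hq
      have hq0 : (0 : ℝ) < q := by exact_mod_cast hpp.1.pos
      have hlog0 : 0 ≤ Real.log q := Real.log_nonneg (by exact_mod_cast hpp.1.one_lt.le)
      have hloglt : Real.log q ≤ lK + L := by
        have := Real.log_le_log hq0 (hpp.2.2.le.trans hvX); linarith
      constructor
      · rw [sub_nonneg, div_le_one hLX0]; exact hloglt
      · rw [sub_le_self_iff]; positivity
    · rw [if_neg hq]; exact ⟨le_rfl, zero_le_one⟩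
  · intro q hq; rw [if_neg hq]
  · intro q hq
    have hpp := mem_primesIn.mp hq
    exact ⟨hpp.1.pos, hpp.2.2, prime_coprime_primesProdBelow hpp.1 (hzW.trans hpp.2.1)⟩
  have hC2' : U2 ≤ V * (M2X + Cu * ε) := by
    refine le_of_eq_of_le ?_ (hC2.trans (le_of_eq ?_))
    · exact Finset.sum_congr rfl fun q hq => by simp only [if_pos hq]
    · congr 2
      exact Finset.sum_congr rfl fun q hq => by
        simp only [if_pos hq]; rw [div_self hlogz0, mul_one]
  -- family S (lower) : `T = {1}`, `Z = z`, `c_q = [q = 1]`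
  have hS := hxl x hxl' {1} z (fun q => if q ∈ ({1} : Finset ℕ) then 1 else 0)
    ⟨le_rfl, hzw⟩ ?_ ?_ ?_
  rotate_left
  · intro q; by_cases hq : q ∈ ({1} : Finset ℕ)
    · rw [if_pos hq]; exact ⟨zero_le_one, le_rfl⟩
    · rw [if_neg hq]; exact ⟨le_rfl, zero_le_one⟩
  · intro q hq; rw [if_neg hq]
  · intro q hq
    rw [Finset.mem_singleton] at hq
    subst hq
    exact ⟨le_rfl, by exact_mod_cast h1v, Nat.coprime_one_left _⟩
  have hS' : V * (f (16 / 3) - Cl * ε) ≤ S₁ := by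
    have e : Real.log (x ^ (16 / 15 : ℝ) / ((1 : ℕ) : ℝ)) / Real.log z = 16 / 3 := by
      rw [Nat.cast_one, div_one, Real.log_rpow hx0, hlogz]; field_simp; ring
    refine le_of_eq_of_le ?_ (hS.trans (le_of_eq ?_))
    · congr 2
      rw [Finset.sum_singleton, if_pos (Finset.mem_singleton_self 1), rhoG_one, e,
        div_self hlogz0]
      simp
    · rw [Finset.sum_singleton, if_pos (Finset.mem_singleton_self 1), one_mul]
  -- collect: multiply the main-term comparisons by `V ≥ 0`
  have hA'' : UA ≤ V * (MA + ε + Cu' * ε) := by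
    refine hA'.trans (mul_le_mul_of_nonneg_left ?_ hV0)
    have : Cu * ε ≤ Cu' * ε := mul_le_mul_of_nonneg_right (le_max_left _ _) hε.le
    linarith
  have hB'' : UB ≤ V * (MB + Cu' * ε) := by
    refine hB'.trans (mul_le_mul_of_nonneg_left ?_ hV0)
    have : Cu * ε ≤ Cu' * ε := mul_le_mul_of_nonneg_right (le_max_left _ _) hε.le
    linarith
  have hN'' : UN ≤ V * (ε + Cu' * ε) := by
    refine (hUN1.trans hN').trans (mul_le_mul_of_nonneg_left ?_ hV0)
    have : Cu * ε ≤ Cu' * ε := mul_le_mul_of_nonneg_right (le_max_left _ _) hε.le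
    linarith
  have hC2'' : U2 ≤ V * (M2 + ε + Cu' * ε) := by
    refine hC2'.trans (mul_le_mul_of_nonneg_left ?_ hV0)
    have : Cu * ε ≤ Cu' * ε := mul_le_mul_of_nonneg_right (le_max_left _ _) hε.le
    linarith
  have hS'' : V * (f (16 / 3) - Cl' * ε) ≤ S₁ :=
    le_trans (mul_le_mul_of_nonneg_left (by gcongr; exact le_max_left _ _) hV0) hS'
  -- conclude
  rw [h3]
  have hS1nonneg : 0 ≤ S₁ := Nat.cast_nonneg _
  have h18 : 0 ≤ 1 - 8 * ε := by linarith
  have h2 : (1 - 8 * ε) * (V * (f (16 / 3) - Cl' * ε)) ≤ (1 - 8 * ε) * S₁ :=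
    mul_le_mul_of_nonneg_left hS'' h18
  have h3' : ε * V * f (16 / 3) ≤ ε * V * |f (16 / 3)| :=
    mul_le_mul_of_nonneg_left (le_abs_self _) (mul_nonneg hε.le hV0)
  have h4 : 0 ≤ ε * ε * (V * Cl') := mul_nonneg (mul_nonneg hε.le hε.le) (mul_nonneg hV0 hCl0)
  have h5 : 0 ≤ V * |f (16 / 3)| := mul_nonneg hV0 (abs_nonneg _)
  linarith [htail, hA'', hB'', hN'', hC2'', h2, h3', h4, h5, hD]

end AssemblyG

/-! ### The lower bound (2) with its slack, and the Theorem, from Proposition 2 for `𝒜_G` -/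

section ConclusionG

/-- **§6 for general `G` with its slack — PROVED.**  From the upper half and the constant-level
lower half of Proposition 2 for `𝒜_G`, the linear-sieve functions `F, f`, the Mertens-type
asymptotics for `ρ_G` (`rhoMertensG`, `tendsto_densityProdG_mul_log'`: `V_G(z) log z →
2Γ_G e^{-γ}`) and the numerical inequality `e^γ/770 < f(16/3) − T3 − T4 − T5` of p. 187: there
is a constant `c₁ > Γ_G/77` with `W(𝒜_G, x^{1/5}) ≥ c₁ x / log x` for all large `x`
(`c₁ = (Γ_G/77)(1 + κ/2)`, `κ = 385 e^{-γ} σ`, `σ` the numerical slack; the general-`G` twin of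
`exists_gt_weightedSum_ge_of_prop2_const`). [cite: IwaniecInventiones1978, §6 pp. 186–187] -/
theorem exists_gt_weightedSumG_ge_of_prop2G_const (ha : 0 < a) (hc : Odd c)
    (hirr : Irreducible (quadPoly a b c)) (h2u : proposition2G_upper a b c)
    (h2l : proposition2G_lower_const a b c)
    {F f : ℝ → ℝ} (hFf : IsLinearSieveFunctions F f)
    (hnum : Real.exp Real.eulerMascheroniConstant / 770 <
      f (16 / 3)
        - (∫ u in (1 / 5 : ℝ)..(1 / 2), (1 - 2 * u) * F ((16 / 15 - u) / u) * ((1 / 5) / u) / u)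
        - (∫ u in (1 / 5 : ℝ)..(1 / 2), F (5 * (16 / 15 - u)))
        - (∫ u in (1 / 2 : ℝ)..1, (1 - u) * F (5 * (16 / 15 - u)) / u)) :
    ∃ c₁ : ℝ, gammaG a b c / 77 < c₁ ∧
      ∀ᶠ x : ℝ in atTop, c₁ * x / Real.log x ≤ weightedSumG a b c x (x ^ (1 / 5 : ℝ)) := by
  set T3 := ∫ u in (1 / 5 : ℝ)..(1 / 2), (1 - 2 * u) * F ((16 / 15 - u) / u) * ((1 / 5) / u) / u
  set T4 := ∫ u in (1 / 5 : ℝ)..(1 / 2), F (5 * (16 / 15 - u))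
  set T5 := ∫ u in (1 / 2 : ℝ)..1, (1 - u) * F (5 * (16 / 15 - u)) / u
  set θ := Real.exp Real.eulerMascheroniConstant / 770 with hθ
  set σ := f (16 / 3) - T3 - T4 - T5 - θ with hσ
  have hσ0 : 0 < σ := by rw [hσ]; linarith
  obtain ⟨C, hC⟩ := weightedSumG_ge_of_prop2G_const ha hc hirr h2u h2l hFf
  set C' := max C 0 with hC'
  have hC'0 : 0 ≤ C' := le_max_right _ _
  -- choice of `ε`
  set ε := min (1 / 8 : ℝ) (σ / (8 * (C' + 1))) with hεdef
  have hε0 : 0 < ε := by rw [hεdef]; positivity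
  have hε8 : ε ≤ 1 / 8 := min_le_left _ _
  have hε4 : ε ≤ 1 / 4 := by linarith
  have hCε : C' * ε ≤ σ / 8 := by
    have h1 : ε ≤ σ / (8 * (C' + 1)) := min_le_right _ _
    have h2 : C' * ε ≤ (C' + 1) * ε := by nlinarith
    calc C' * ε ≤ (C' + 1) * ε := h2
      _ ≤ (C' + 1) * (σ / (8 * (C' + 1))) := by gcongr
      _ = σ / 8 := by field_simp
  have hx₀ := hC ε hε0 hε8
  -- the three main-sum bounds with `δ = σ/8`
  have hδ : 0 < σ / 8 := by positivity
  have hA := MA_leG ha hc hirr hFf hδ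
  have hB := MB_leG ha hc hirr hFf hδ
  have h2 := M2_leG ha hc hirr hFf hε0 hε4 hδ
  have hT5 := T5_trunc_le hFf hε0 (by linarith)
  have hV := tendsto_densityProdG_mul_log' ha hc hirr
  -- the density: eventually `V(z) log z ≥ (1 − η) C₀ e^{-γ}`
  set C₀ := 2 * gammaG a b c * Real.exp (-Real.eulerMascheroniConstant) with hC₀
  have hg := gammaG_pos ha hc hirr
  have hC₀pos : 0 < C₀ := by
    rw [hC₀]; exact mul_pos (by linarith) (Real.exp_pos _)
  set κ := 385 * Real.exp (-Real.eulerMascheroniConstant) * σ with hκ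
  have hκ0 : 0 < κ := by positivity
  set η := κ / (2 * (1 + κ)) with hη
  have hη0 : 0 < η := by positivity
  have hη1 : η < 1 := by
    rw [hη, div_lt_one (by positivity)]; nlinarith
  have hVev : ∀ᶠ x : ℝ in atTop,
      (1 - η) * C₀ ≤ densityProdG a b c (x ^ (1 / 5 : ℝ)) * Real.log (x ^ (1 / 5 : ℝ)) := by
    have ht := hV.comp (tendsto_rpow_atTop (by norm_num : (0 : ℝ) < 1 / 5))
    have hlt : (1 - η) * C₀ < C₀ := by nlinarith
    exact ht.eventually_const_le hlt
  -- the constant: `c = 5 (1 − η) C₀ (θ + σ/2) = (Γ/77)(1 + κ/2) > Γ/77`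
  have hkey : gammaG a b c / 77 < (1 - η) * C₀ / (1 / 5) * (θ + σ / 2) := by
    have hexp :
        Real.exp (-Real.eulerMascheroniConstant) * Real.exp Real.eulerMascheroniConstant = 1 := by
      rw [← Real.exp_add]; simp
    have h1 : (1 - η) * (1 + κ) = 1 + κ / 2 := by
      rw [hη]; field_simp; ring
    have hE := Real.exp_pos (-Real.eulerMascheroniConstant)
    rw [hC₀, hθ]
    have : (1 - η) * (2 * gammaG a b c * Real.exp (-Real.eulerMascheroniConstant)) / (1 / 5) *
        (Real.exp Real.eulerMascheroniConstant / 770 + σ / 2) =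
        gammaG a b c / 77 * ((1 - η) * (1 + κ)) := by
      rw [hκ]; linear_combination ((1 - η) * gammaG a b c / 77) * hexp
    rw [this, h1]
    have hpos : 0 < gammaG a b c / 77 * (κ / 2) := by positivity
    have hexpand : gammaG a b c / 77 * (1 + κ / 2) =
        gammaG a b c / 77 + gammaG a b c / 77 * (κ / 2) := by ring
    rw [hexpand]
    linarith
  refine ⟨(1 - η) * C₀ / (1 / 5) * (θ + σ / 2), hkey, ?_⟩
  -- assemble
  filter_upwards [hA, hB, h2, hVev, hx₀, eventually_gt_atTop (1 : ℝ)]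
    with x hxA hxB hx2 hxV hmain hx1
  have hx0 : 0 < x := by linarith
  have hL0 : 0 < Real.log x := Real.log_pos hx1
  set V := densityProdG a b c (x ^ (1 / 5 : ℝ)) with hVx
  have hlogz : Real.log (x ^ (1 / 5 : ℝ)) = (1 / 5) * Real.log x := Real.log_rpow hx0 _
  have hV0 : 0 ≤ V := by
    have := hxV
    rw [hlogz] at this
    have h1 : 0 < (1 - η) * C₀ := mul_pos (by linarith) hC₀pos
    by_contra hneg
    rw [not_le] at hneg
    have : V * (1 / 5 * Real.log x) < 0 := mul_neg_of_neg_of_pos hneg (by positivity)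
    linarith
  -- lower bound for the bracket
  have hbr : f (16 / 3) - T3 - T4 - T5 - σ / 2 ≤
      f (16 / 3)
        - ∑ p ∈ primesIn (x ^ (1 / 5 : ℝ)) (x ^ (1 / 2 : ℝ)),
            (1 - 2 * Real.log p / Real.log x) * (rhoG a b c p : ℝ) / p *
              F (Real.log (x ^ (16 / 15 : ℝ) / p) / Real.log p) *
                (Real.log (x ^ (1 / 5 : ℝ)) / Real.log p)
        - ∑ p ∈ primesIn (x ^ (1 / 5 : ℝ)) (x ^ (1 / 2 : ℝ)),
            Real.log p / Real.log x * (rhoG a b c p : ℝ) / p *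
              F (Real.log (x ^ (16 / 15 : ℝ) / p) / Real.log (x ^ (1 / 5 : ℝ)))
        - ∑ p ∈ primesIn (x ^ (1 / 2 : ℝ)) (x ^ (1 - ε)),
            (1 - Real.log p / Real.log x) * (rhoG a b c p : ℝ) / p *
              F (Real.log (x ^ (16 / 15 : ℝ) / p) / Real.log (x ^ (1 / 5 : ℝ)))
        - C * ε := by
    have hCC : C * ε ≤ C' * ε := mul_le_mul_of_nonneg_right (le_max_left _ _) hε0.le
    linarith [hxA, hxB, hx2, hT5, hCε, hCC]
  have hW : V * x * (f (16 / 3) - T3 - T4 - T5 - σ / 2) ≤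
      weightedSumG a b c x (x ^ (1 / 5 : ℝ)) :=
    le_trans (mul_le_mul_of_nonneg_left hbr (mul_nonneg hV0 hx0.le)) hmain
  -- `f(16/3) − T3 − T4 − T5 − σ/2 = θ + σ/2`
  have hval : f (16 / 3) - T3 - T4 - T5 - σ / 2 = θ + σ / 2 := by rw [hσ]; ring
  rw [hval] at hW
  -- compare `V x (θ + σ/2)` with `c x / log x`
  have hVlow : (1 - η) * C₀ / ((1 / 5) * Real.log x) ≤ V := by
    rw [div_le_iff₀ (by positivity), ← hlogz]; exact hxV
  calc (1 - η) * C₀ / (1 / 5) * (θ + σ / 2) * x / Real.log x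
        = (1 - η) * C₀ / (1 / 5) * (θ + σ / 2) * (x / Real.log x) := by ring
    _ = (1 - η) * C₀ / ((1 / 5) * Real.log x) * x * (θ + σ / 2) := by
        field_simp
    _ ≤ V * x * (θ + σ / 2) :=
        mul_le_mul_of_nonneg_right (mul_le_mul_of_nonneg_right hVlow hx0.le) (by positivity)
    _ ≤ weightedSumG a b c x (x ^ (1 / 5 : ℝ)) := hW

/-- **Iwaniec's (2) for general `G`, with a constant `> 1/77` — PROVED from Proposition 2 for
`𝒜_G`:** `∃ C > 1/77`, `W(𝒜_G, x^{1/5}) ≥ C Γ_G x/log x` for all large `x` (the pair `(F, f)`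
from `exists_isLinearSieveFunctions`, the numerics from `IsLinearSieveFunctions.numerics`).
This is exactly the hypothesis of `theorem_quadratic_of_weightedSumG_lower` for `G`.
[cite: IwaniecInventiones1978, §2 (2) and §6 p. 187] -/
theorem weightedSumG_lower_of_prop2G (ha : 0 < a) (hc : Odd c)
    (hirr : Irreducible (quadPoly a b c)) (h2u : proposition2G_upper a b c)
    (h2l : proposition2G_lower_const a b c) :
    ∃ C : ℝ, 1 / 77 < C ∧ ∀ᶠ x : ℝ in atTop,
      C * gammaG a b c * x / Real.log x ≤ weightedSumG a b c x (x ^ (1 / 5 : ℝ)) := by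
  obtain ⟨F, f, hFf⟩ := exists_isLinearSieveFunctions
  obtain ⟨c₁, hc₁, hev⟩ :=
    exists_gt_weightedSumG_ge_of_prop2G_const ha hc hirr h2u h2l hFf hFf.numerics
  have hΓ := gammaG_pos ha hc hirr
  refine ⟨c₁ / gammaG a b c, ?_, ?_⟩
  · rw [lt_div_iff₀ hΓ]; linarith
  · filter_upwards [hev] with x hx
    rwa [div_mul_cancel₀ c₁ hΓ.ne']

/-- **Iwaniec's Theorem for every `G = aX² + bX + c` (`a > 0`, `c` odd, `G` irreducible) from
Proposition 2 for the sequences `𝒜_G` — PROVED:**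
`(∀ G, proposition2G_upper G ∧ proposition2G_lower_const G) → theorem_quadratic`.
So the general Theorem (display (1) with the constant `1/77`, and `G(n) = P₂` infinitely often)
rests on Lemke Oliver's Lemma 5 = Iwaniec's Proposition 2 for `𝒜_G` alone, i.e. on the
bilinear-remainder linear sieve (`lemma2_bilinearSieve`) and the level of distribution `x^{16/15}`
of `𝒜_G` in bilinear form (Iwaniec's Corollary of Proposition 1 for general `G`).
[cite: IwaniecInventiones1978, Theorem p. 172] -/
theorem theorem_quadratic_of_prop2G
    (h : ∀ a b c : ℤ, 0 < a → Odd c → Irreducible (quadPoly a b c) →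
      proposition2G_upper a b c ∧ proposition2G_lower_const a b c) :
    theorem_quadratic :=
  theorem_quadratic_of_weightedSumG_lower fun a b c ha hc hirr =>
    weightedSumG_lower_of_prop2G ha hc hirr (h a b c ha hc hirr).1 (h a b c ha hc hirr).2

/-- The qualitative half alone: `Ω(|G(n)|) ≤ 2` for infinitely many `n`, from Proposition 2 for
`𝒜_G` (through `infinite_setOf_isAtMostAlmostPrime_of_weightedSumG_pos`; Lemke Oliver's
endpoint "`W(𝒜, z) ≫ x/log x`", Theorem 1). [cite: LemkeOliverActaArith2012, Theorem 1] -/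
theorem infinite_setOf_isAtMostAlmostPrime_of_prop2G (ha : 0 < a) (hc : Odd c)
    (hirr : Irreducible (quadPoly a b c)) (h2u : proposition2G_upper a b c)
    (h2l : proposition2G_lower_const a b c) :
    {n : ℕ | Nat.IsAtMostAlmostPrime 2 (a * (n : ℤ) ^ 2 + b * n + c).natAbs}.Infinite := by
  obtain ⟨C, hC, hev⟩ := weightedSumG_lower_of_prop2G ha hc hirr h2u h2l
  have hΓ := gammaG_pos ha hc hirr
  refine infinite_setOf_isAtMostAlmostPrime_of_weightedSumG_pos ha hirr
    ⟨C * gammaG a b c, by positivity, ?_⟩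
  filter_upwards [hev] with x hx
  exact hx

end ConclusionG

end Literature.NumberTheory.Sieve.Iwaniec1978

end
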